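import Literature.MathematicalPhysics.QuantumFieldTheory.Balaban1983to89.B9SectBStepUParHOfMembers
import Literature.MathematicalPhysics.QuantumFieldTheory.Balaban1983to89.B9SectBFramesSelY

/-!
# `Balaban1983to89.B9SectBStepsUParG` — T. Bałaban, *Propagators for lattice gauge theories in a background field*, Commun. Math. Phys. **99** (1985)
# 389–434 [Balaban1985BackgroundPropagators], Thm 3.4 p. 400, Sect. B pp. 400–407, Thm 3.1 (3.42)–(3.47) p. 398, Thm 3.2 (3.48) p. 398, (3.21) p. 394,
# (3.40) p. 397, (3.35)–(3.37) p. 396: THE G′-SIDE MEMBERS OF THE TWO-TRANSPORTER SECT.-B STEP `KSCUPar parA parH` WITH THE AVERAGING-TRANSPORTER LAWS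
# GUARDED BY (3.35) (pub-ymgap N06 [B9]; cure (α) of ⚑ LOCATED-29, module S4 — the `…G` twins of the step theorems of `B9SectBCodedFamiliesUParH`,
# `B9SectBL2StepUParH`, `B9SectBH1StepUParH`, `B9SectBH2StepUParH`)

statement-level skeleton of published theorems with citation tags; proofs where landed; nothing here is a claim about the Yang–Mills mass gap

THE PRINT.  Sect. B (pp. 400–407) proves the step `U ↦ U′U` of Theorem 3.4 for the G′-side members (3.42)–(3.48) at configurations `U` in (3.35) and `U′` in
(3.37); the averaging contours (3.21) and the laws of their transporters are used there only.

WHY THIS FILE (director-ym №383 CASCADE-K, seat dag-n06-c; ⚑ LOCATED-29, node00-def-Y RULING (α), INTENT-8 GO).  Modules F1–F3 of the (C) road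
(`B9SectBCodedFamiliesUParH`, `B9SectBL2StepUParH`, `B9SectBH1StepUParH`, `B9SectBH2StepUParH`) prove the eight G′-side members of the two-transporter step for
`(KSCUPar parA parH, KACU, pullS C⁻¹)` with the averaging-transporter laws `hpar ∕ hunit ∕ hunitX` displayed at every `G`-valued configuration.  THIS FILE is
their edition with the laws GUARDED (`hparG ∕ hparC ∕ hunitG ∕ hunitXG`, the shapes of `B9SectBFramesSelY`): the same proofs on the `…Sel` frame constructors
(`gpFrame₂CodedOnSel`, `anFrame₂CodedOnSel`, `cinvFrame₃CodedOnSel`, `e4Frame₃CodedOnSel`) and on this file's `…ParSel` frames (`l2Frame₂CodedOnParSel`,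
`h1Frame₃CodedOnParSel`, `h2Frame₃CodedOnParSel` — F1b∕F2∕F3's frames on the root `gpFrame₂CodedOnSel`, their transfer fields rewriting the selected transporter
on the regime).  The family-level transports (`hin_KSCUPar_on_pos`, `houtE ∕ houtEGlob ∕ houtL2_KSCUPar_on`, `hin_KSCUPar₃_on_pos`, the `KSC₇Par ∕ KSC₃Par` block
identities, `h1 ∕ h2_transfer_KSC₇Par`) are F1–F3's, USED BY NAME (they read no averaging-transporter law).

CONTENTS.  §1 (3.42), (3.47), (3.44), (3.48), analyticity: `stepEPos ∕ stepGlobPos ∕ stepE4Pos ∕ stepKerPos ∕ stepAnalyticPos1 ∕ stepAnalyticPos_KSCUParG_on`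
(+ `stepKerPos_KSC₇ParG_cinv_on`); §2 (3.46): `l2Frame₂CodedOnParSel`, `stepL2nPos ∕ stepL2Pos_KSC₃ParG_on`, `stepL2Pos_KSCUParG_on`; §3 (3.43): `h1Frame₃CodedOnParSel`,
`stepH1Pos_KSC₇ParG_on`, `stepH1Pos_KSCUParG_on`, `stepH1Pos_KSCUParG_parSymYH_on`; §4 (3.45): `h2Frame₃CodedOnParSel`, `stepH2Pos_KSC₇ParG_on`, `stepH2Pos_KSCUParG_on`.

HONEST SCOPE.  Re-threading bookkeeping; every proof is F1–F3's at the `…Sel` constructors; nothing of [B9] asserted beyond F1–F3's displayed hypotheses (now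
weaker); COUNT-NEUTRAL; N06 NOT discharged; one finite lattice programme — nothing continuum ∕ OS ∕ mass-gap ∕ Clay.  Cell `pub-ymgap` (HUMAN RULING D-0062),
Track A node N06 [B9], CASCADE-K (№383), cure (α) of LOCATED-29, module S4.

RELATED IN THE TREE, NOT DUPLICATED: F1–F3 (the unguarded originals and the family-level transports), `B9SectBFramesSelY` ∕ `B9SectBParSelY` (constructors, device),
the generic steps `B9SectBGpStepAtLettersV2`, `B9SectBKerFrameV3`, `B9SectBE4FrameCodedY`, `B9SectBH1FrameCodedY`, `B9SectBH2FrameCodedY`, `B9SectBL2StepAtLettersV2*`,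
`B9SectBStepPosFamilyTransfer`, `B9SectBStepL2FamilyTransferPos` — USED BY NAME; no existing module modified.
-/

noncomputable section

namespace Literature.MathematicalPhysics.QuantumFieldTheory.Balaban1983to89.B9SectBStepsUParG

open Literature.MathematicalPhysics.QuantumFieldTheory.Balaban1983to89.B9SectBCodedClassR (RegExtraY bg9YC)

variable {d ℓ : ℕ} {hd : 1 ≤ d + 1} {hL : Odd (ℓ + 1) ∧ 1 < ℓ + 1} {b₀ b₁ : ℝ} {Mstar : ℕ}
variable {𝔸 : Type} [NormedRing 𝔸] (P : RegExtraY d ℓ hd hL b₀ b₁ Mstar 𝔸) [NormedAlgebra ℂ 𝔸] [CompleteSpace 𝔸]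

/-! ## §1 The (3.42), (3.47), (3.44), (3.48) and analyticity members -/

section EGlobE4KerAn

open Literature.MathematicalPhysics.QuantumFieldTheory.Balaban1983to89.B9SectBCodedClassR (RegExtraY bg9YC)
open B6RandomWalk (HasMajorant hasMajorant_mono BlockSupp)
open B6KLevelCensusIndexV1 (KIdx kGeo)
open B6Ineq2142KLevelV1 (β)
open B9Thm34Ext (toB6)
open B9FromB6 (EBlock H1Block E4Block H2Block L2Block GlobBlock)
open B9SectBCodedCarrier (CCfg Coding pullK pullS)
open B9Eq360DeltaPrimeAY (AfldY)
open B9PinMembersKLevelV1 (MemberY geo9Y bg9Y)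
open B9SectBGpLettersY (GVal decY)
open B9SectBGpFrameCodedYR (codingYx Read342Y Write342Y)
open B9SectBGpFrameCodedY (CplxLettersY)
open B9SectBGpReadingsYR (KSC read342Y_KSC write342Y_KSC)
open B9SectBGpReadingsY (baseY)
open B9SectBCodedReadingsUR (KSCU KACU)
open B9SectBCodedReadingsUParH (KSCUPar)
open B9SectBStepsKSCUR (KACU_members_base ineq342_346_347_congr)
open B9SectBStepsKSCUBlocksR (eBlock_KSCU_of_KSC globBlock_KSCU_of_eBlock_KSC)
open B9SectBGpTransferInYR (ineq343_345_congr ineq342_346_347_mono eBlock_KSC_base KSC_members_base pullK_members_base)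
open B9SectBCodedChainOnSubfamilyR (gpFrame₂CodedOn)
open B9SectBEGlobAnStepRecordOnR (stepEPos_KSC_on)
open B9SectBCodedChainAnR (IsAnKY anFrame₂CodedOn)
open B9SectBCodedChainL2R (thms_mono_B₀)
open B9SectBStepPosFamilyTransfer (stepPos_of_family_pos stepEPos_of_family_pos stepPos_blk_of_family_pos stepE4Pos_of_family_pos stepKerPos_of_family_pos)
open B9SectBStepWhole (StepEPos StepGlobPos StepE4Pos StepKerPos StepAnalyticPos1 StepAnalyticPos stepAnalyticPos_of_halves)
open B9SectBGpStepAtLettersV2 (stepEPos_of_gpFrame₂ stepAnalyticPos1_of_anFrame₂)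
open B9SectBKerFrameV3 (stepKerPos_of_cinvFrame₃)
open B9SectBKerFrameCodedYR (CinvY cinvFrame₃CodedOn)
open B9SectBE4FrameCodedY (stepE4Pos_of_e4Frame₃)
open B9SectBE4FrameCodedYR (KSC₆ eBlock_KSC₆_iff e4Block_KSC₆_iff e4Frame₃CodedOn)
open B9SectBH1FrameCodedYR (KSC₅)
open B9SectBH2FrameCodedYR (KSC₇)
open B9SectBH1ReadWriteY (h1ReadT)
open B9GeoNbrCountKLevelV1 (exists_card_nbr_geo9Y_le_of_M)
open B9RWSumsReadsNbr (nbr)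
open B9GeoNormsKLevelV1 (geo9K_wNorm_nonneg)
open Node00 (SiteY BlkY IBondY CfgY BallY SiteParY BondParY BondOpY liftY deltaPrimeAY kernelFamilyS kernelFamilyB GpY XY cdS cdsS hqS)
open Literature.MathematicalPhysics.QuantumFieldTheory.Balaban1983to89.B9SectBParSelY
open Literature.MathematicalPhysics.QuantumFieldTheory.Balaban1983to89.B9SectBFramesSelY (gpFrame₂CodedOnSel anFrame₂CodedOnSel cinvFrame₃CodedOnSel e4Frame₃CodedOnSel)
open Literature.MathematicalPhysics.QuantumFieldTheory.Balaban1983to89.B9SectBCodedFamiliesUParH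
open Literature.MathematicalPhysics.QuantumFieldTheory.Balaban1983to89.B9SectBL2StepUParH (KSC₃Par KSC₃Par_members KSC₃Par_members₇ eBlock_KSC₃Par_iff l2Block_KSC₃Par_iff read342Y_KSC₃Par write342Y_KSC₃Par hin_KSCUPar₃_on_pos houtL2_KSCUPar_on)
open Literature.MathematicalPhysics.QuantumFieldTheory.Balaban1983to89.B9SectBH1StepUParH (h1_transfer_KSC₇Par)
open Literature.MathematicalPhysics.QuantumFieldTheory.Balaban1983to89.B9SectBH2StepUParH (h2_transfer_KSC₇Par)

variable {J : Type} (f : J → MemberY d ℓ hd hL b₀ b₁ Mstar) [∀ x : MemberY d ℓ hd hL b₀ b₁ Mstar, Fintype (geo9Y x).Site]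
  (c35 : ℝ) (G : Subgroup 𝔸ˣ) (parA parH : ∀ j : J, SiteParY 𝔸 (f j).toKIdx) (OA : ∀ j : J, BondOpY 𝔸 (f j).toKIdx)
  (parB : ∀ j : J, BondParY 𝔸 (f j).toKIdx) {ι : Type} [Fintype ι] (b : Module.Basis ι ℝ 𝔸)
  (ιB : ∀ j : J, BlkY (f j).toKIdx → IBondY (f j).toKIdx)
  (C37 C38 : ∀ j : J, ℝ → CfgY 𝔸 (f j).toKIdx → AfldY 𝔸 (f j).toKIdx → Prop)
  (Cinv : ∀ j : J, B9.SiteKernel (geo9Y (f j)) (bg9YC 𝔸 G P (f j))) [FiniteDimensional ℝ 𝔸]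
variable [∀ x : MemberY d ℓ hd hL b₀ b₁ Mstar, DecidableEq (geo9Y x).Site] [∀ x : MemberY d ℓ hd hL b₀ b₁ Mstar, Nonempty (geo9Y x).Site] [NormOneClass 𝔸]
  [DecidableEq ι]

/-- ★ **`StepEPos` OF THE TWO-TRANSPORTER READING over the coded carrier** (input families `(KSCUPar, KACU, pullS C⁻¹)`; output `KSCUPar`'s (3.42) block at the
product): the root-frame step `stepEPos_of_gpFrame₂` AT `KSC₇Par` (dictionaries `read342Y_KSC₇Par ∕ write342Y_KSC₇Par`), transported by `stepEPos_of_family_pos` —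
`hin_KSCUPar_on_pos`, `houtE_KSCUPar_on`.  Displayed: the root frame's structural data with the laws `hparG hparC hunitG hC37` (GUARDED by (3.35)∕(3.37)) AT THE AVERAGING TRANSPORTER `parA`; no law of
`parH`. [cite: Balaban1985BackgroundPropagators, Thm 3.1 (3.42) p.397, Thm 3.4 p.400, (3.60)–(3.64) p.402, p.403 l.1–9, (3.35)–(3.37) p.396; Balaban1984PropagatorsII, Lemma 2.1 p.234, (2.51) p.232] -/
theorem stepEPos_KSCUParG_on (hι : ∀ (j : J) (s : BlkY (f j).toKIdx), β (f j).toKIdx.hN (f j).toKIdx.D (f j).toKIdx.hk (ιB j s) = s)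
    (hG1 : ∀ u : 𝔸ˣ, u ∈ G → ‖(u : 𝔸)‖ ≤ 1)
    (dB : ℕ) (M₂ : ℝ) (hM₂ : 0 ≤ M₂) (hrepr : ∀ (v : 𝔸) (j : ι), |b.repr v j| ≤ M₂ * ‖v‖) (hcR : 0 < M₂ * ∑ j, ‖b j‖)
    (Cq : ℝ) (hCq : 0 ≤ Cq) (hC37 : ∀ j β' U a, C37 j β' U a → GVal G (f j).toKIdx U ∧ CplxLettersY G (f j) (parA j) (ιB j) Cq β' U a)
    (MInv aInv aW : ℝ) (hMInv : 0 < MInv) (haInv : 0 < aInv) (haW : 0 < aW)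
    (hparG : ∀ j (α₀ : ℝ) (U : CfgY 𝔸 (f j).toKIdx), MInv ≤ (geo9Y (f j)).M → 0 < α₀ → (geo9Y (f j)).M * α₀ ≤ aInv →
      (bg9YC 𝔸 G P (f j)).Reg335 c35 α₀ U → ∀ z w, parA j U z w ∈ G)
    (hparC : ∀ j β' U a, C37 j β' U a → ∀ z w, parA j U z w ∈ G)
    (hunitG : ∀ j (α₀ : ℝ) (U : CfgY 𝔸 (f j).toKIdx), MInv ≤ (geo9Y (f j)).M → 0 < α₀ → (geo9Y (f j)).M * α₀ ≤ aInv →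
      (bg9YC 𝔸 G P (f j)).Reg335 c35 α₀ U → IsUnit (deltaPrimeAY (f j).toKIdx (parA j) U)) :
    StepEPos dB c35 (fun j => geo9Y (f j)) (fun j => (codingYx P G (f j) (C37 j) (C38 j)).bg)
      (fun j => KSCUPar P G (f j) (parA j) (parH j) (C37 j) (C38 j)) (fun j => KACU P G (f j) (OA j) (parB j) (C37 j) (C38 j))
      (fun j => pullS (codingYx P G (f j) (C37 j) (C38 j)) (Cinv j)) (fun j => KSCUPar P G (f j) (parA j) (parH j) (C37 j) (C38 j)) :=
  stepEPos_of_family_pos dB c35 (fun j => geo9Y (f j)) (fun j => (codingYx P G (f j) (C37 j) (C38 j)).bg)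
    (fun j => KSC₇Par P G (f j) (parA j) (parH j) (C37 j) (C38 j)) (fun j => KSCUPar P G (f j) (parA j) (parH j) (C37 j) (C38 j))
    (fun j => KACU P G (f j) (OA j) (parB j) (C37 j) (C38 j)) (fun j => KACU P G (f j) (OA j) (parB j) (C37 j) (C38 j))
    (fun j => pullS (codingYx P G (f j) (C37 j) (C38 j)) (Cinv j))
    (fun j => KSC₇Par P G (f j) (parA j) (parH j) (C37 j) (C38 j)) (fun j => KSCUPar P G (f j) (parA j) (parH j) (C37 j) (C38 j))
    (hin_KSCUPar_on_pos P f c35 G parA parH OA parB b ιB C37 C38 Cinv hι hG1 hM₂ hrepr dB)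
    (houtE_KSCUPar_on P f c35 G parA parH b ιB C37 C38 hι hM₂ hrepr hcR)
    (stepEPos_of_gpFrame₂ (d := dB)
      (gpFrame₂CodedOnSel P f c35 G b C37 C38 parA ιB (fun j => KSC₇Par P G (f j) (parA j) (parH j) (C37 j) (C38 j)) hι hG1 dB M₂ hM₂ hrepr Cq hCq hC37
        (M₂ * ∑ j, ‖b j‖) hcR (fun B _ => (M₂ * ∑ j, ‖b j‖) * B + 1) (fun B _ hB _ => by positivity) (fun δ => δ) (fun δ hδ => hδ)
        MInv aInv aW hMInv haInv haW hparG hparC hunitG (fun j => read342Y_KSC₇Par P G (f j) (parA j) (parH j) b (ιB j) (C37 j) (C38 j) (hι j) M₂ hM₂ hrepr c35 MInv aInv)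
        (fun j => write342Y_KSC₇Par P G (f j) (parA j) (parH j) b (ιB j) (C37 j) (C38 j) (hι j) M₂ hM₂ hrepr aW fun β' U a h => (hC37 j β' U a h).1))
      _ _)

/-- ★ **`StepGlobPos` OF THE TWO-TRANSPORTER READING over the coded carrier** — the (3.47) block at the product recovered from the root-frame (3.42) step AT `KSC₇Par`
(`stepPos_blk_of_family_pos`: `EBlock KSC₇Par ↦ GlobBlock KSCUPar`, `houtEGlob_KSCUPar_on`); laws displayed at `parA` only.
[cite: Balaban1985BackgroundPropagators, Thm 3.1 (3.47) p.398 + p.398 first remark, Thm 3.4 p.400, p.402, p.403 l.1–9; Balaban1984PropagatorsII, Lemma 2.1 p.234] -/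
theorem stepGlobPos_KSCUParG_on (hι : ∀ (j : J) (s : BlkY (f j).toKIdx), β (f j).toKIdx.hN (f j).toKIdx.D (f j).toKIdx.hk (ιB j s) = s)
    (hG1 : ∀ u : 𝔸ˣ, u ∈ G → ‖(u : 𝔸)‖ ≤ 1)
    (dB : ℕ) (M₂ : ℝ) (hM₂ : 0 ≤ M₂) (hrepr : ∀ (v : 𝔸) (j : ι), |b.repr v j| ≤ M₂ * ‖v‖) (hcR : 0 < M₂ * ∑ j, ‖b j‖)
    (Cq : ℝ) (hCq : 0 ≤ Cq) (hC37 : ∀ j β' U a, C37 j β' U a → GVal G (f j).toKIdx U ∧ CplxLettersY G (f j) (parA j) (ιB j) Cq β' U a)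
    (MInv aInv aW : ℝ) (hMInv : 0 < MInv) (haInv : 0 < aInv) (haW : 0 < aW)
    (hparG : ∀ j (α₀ : ℝ) (U : CfgY 𝔸 (f j).toKIdx), MInv ≤ (geo9Y (f j)).M → 0 < α₀ → (geo9Y (f j)).M * α₀ ≤ aInv →
      (bg9YC 𝔸 G P (f j)).Reg335 c35 α₀ U → ∀ z w, parA j U z w ∈ G)
    (hparC : ∀ j β' U a, C37 j β' U a → ∀ z w, parA j U z w ∈ G)
    (hunitG : ∀ j (α₀ : ℝ) (U : CfgY 𝔸 (f j).toKIdx), MInv ≤ (geo9Y (f j)).M → 0 < α₀ → (geo9Y (f j)).M * α₀ ≤ aInv →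
      (bg9YC 𝔸 G P (f j)).Reg335 c35 α₀ U → IsUnit (deltaPrimeAY (f j).toKIdx (parA j) U)) :
    StepGlobPos dB c35 (fun j => geo9Y (f j)) (fun j => (codingYx P G (f j) (C37 j) (C38 j)).bg)
      (fun j => KSCUPar P G (f j) (parA j) (parH j) (C37 j) (C38 j)) (fun j => KACU P G (f j) (OA j) (parB j) (C37 j) (C38 j))
      (fun j => pullS (codingYx P G (f j) (C37 j) (C38 j)) (Cinv j)) (fun j => KSCUPar P G (f j) (parA j) (parH j) (C37 j) (C38 j)) := by
  refine stepPos_blk_of_family_pos dB c35 (fun j => geo9Y (f j)) (fun j => (codingYx P G (f j) (C37 j) (C38 j)).bg)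
    (fun j => KSC₇Par P G (f j) (parA j) (parH j) (C37 j) (C38 j)) (fun j => KSCUPar P G (f j) (parA j) (parH j) (C37 j) (C38 j))
    (fun j => KACU P G (f j) (OA j) (parB j) (C37 j) (C38 j)) (fun j => KACU P G (f j) (OA j) (parB j) (C37 j) (C38 j))
    (fun j => pullS (codingYx P G (f j) (C37 j) (C38 j)) (Cinv j))
    (C₁ := ℝ × ℝ) (C₂ := ℝ) (pos₁ := fun c => 0 < c.1 ∧ 0 < c.2) (pos₂ := fun c => 0 < c)
    (Blk₁ := fun c j W => EBlock (KSC₇Par P G (f j) (parA j) (parH j) (C37 j) (C38 j)) c.1 c.2 W)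
    (Blk₂ := fun c j W => GlobBlock (KSCUPar P G (f j) (parA j) (parH j) (C37 j) (C38 j)) c W)
    (hin_KSCUPar_on_pos P f c35 G parA parH OA parB b ιB C37 C38 Cinv hι hG1 hM₂ hrepr dB) (fun c hc a ha => ?_)
    (stepEPos_of_gpFrame₂ (d := dB)
      (gpFrame₂CodedOnSel P f c35 G b C37 C38 parA ιB (fun j => KSC₇Par P G (f j) (parA j) (parH j) (C37 j) (C38 j)) hι hG1 dB M₂ hM₂ hrepr Cq hCq hC37
        (M₂ * ∑ j, ‖b j‖) hcR (fun B _ => (M₂ * ∑ j, ‖b j‖) * B + 1) (fun B _ hB _ => by positivity) (fun δ => δ) (fun δ hδ => hδ)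
        MInv aInv aW hMInv haInv haW hparG hparC hunitG (fun j => read342Y_KSC₇Par P G (f j) (parA j) (parH j) b (ιB j) (C37 j) (C38 j) (hι j) M₂ hM₂ hrepr c35 MInv aInv)
        (fun j => write342Y_KSC₇Par P G (f j) (parA j) (parH j) b (ιB j) (C37 j) (C38 j) (hι j) M₂ hM₂ hrepr aW fun β' U a h => (hC37 j β' U a h).1))
      _ _)
  obtain ⟨Mo, ao, a', B', hao, ha', ha'a, hB', H⟩ := houtEGlob_KSCUPar_on P f c35 G parA parH b ιB C37 C38 hι hM₂ hrepr c.1 c.2 a hc.1 hc.2 ha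
  exact ⟨Mo, ao, a', B', hao, ha', ha'a, hB', H⟩

/-- ★ **`StepE4Pos` OF THE TWO-TRANSPORTER READING over the coded carrier** (the (3.44) member; input families `(KSCUPar, KACU, pullS C⁻¹)`): the (3.44) frame
`e4Frame₃CodedOn` AT `parA` (family `KSC₆ parA`) RE-KEYED to `KSC₇Par` by `E4Frame₃.swapGp` (same (3.42) and (3.44) blocks — the (3.44) member does not read the
transporter), its step `stepE4Pos_of_e4Frame₃`, transported by `stepE4Pos_of_family_pos` (`hin_KSCUPar_on_pos`, identity output).  Laws displayed at `parA` only.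
[cite: Balaban1985BackgroundPropagators, Thm 3.4 p.400, (3.44) p.398, p.403 l.2–5, (3.60)–(3.65) pp.402–403; Balaban1984PropagatorsII, Lemma 2.1 p.234, (2.51)–(2.52) p.232] -/
theorem stepE4Pos_KSCUParG_on (hι : ∀ (j : J) (s : BlkY (f j).toKIdx), β (f j).toKIdx.hN (f j).toKIdx.D (f j).toKIdx.hk (ιB j s) = s)
    (hG1 : ∀ u : 𝔸ˣ, u ∈ G → ‖(u : 𝔸)‖ ≤ 1)
    (dB : ℕ) (M₂ : ℝ) (hM₂ : 0 ≤ M₂) (hrepr : ∀ (v : 𝔸) (j : ι), |b.repr v j| ≤ M₂ * ‖v‖) (hcR : 0 < M₂ * ∑ j, ‖b j‖)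
    (Cq : ℝ) (hCq : 0 ≤ Cq) (hC37 : ∀ j β' U a, C37 j β' U a → GVal G (f j).toKIdx U ∧ CplxLettersY G (f j) (parA j) (ιB j) Cq β' U a)
    (MInv aInv aW : ℝ) (hMInv : 0 < MInv) (haInv : 0 < aInv) (haW : 0 < aW)
    (hparG : ∀ j (α₀ : ℝ) (U : CfgY 𝔸 (f j).toKIdx), MInv ≤ (geo9Y (f j)).M → 0 < α₀ → (geo9Y (f j)).M * α₀ ≤ aInv →
      (bg9YC 𝔸 G P (f j)).Reg335 c35 α₀ U → ∀ z w, parA j U z w ∈ G)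
    (hparC : ∀ j β' U a, C37 j β' U a → ∀ z w, parA j U z w ∈ G)
    (hunitG : ∀ j (α₀ : ℝ) (U : CfgY 𝔸 (f j).toKIdx), MInv ≤ (geo9Y (f j)).M → 0 < α₀ → (geo9Y (f j)).M * α₀ ≤ aInv →
      (bg9YC 𝔸 G P (f j)).Reg335 c35 α₀ U → IsUnit (deltaPrimeAY (f j).toKIdx (parA j) U)) :
    StepE4Pos dB c35 (fun j => geo9Y (f j)) (fun j => (codingYx P G (f j) (C37 j) (C38 j)).bg)
      (fun j => KSCUPar P G (f j) (parA j) (parH j) (C37 j) (C38 j)) (fun j => KACU P G (f j) (OA j) (parB j) (C37 j) (C38 j))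
      (fun j => pullS (codingYx P G (f j) (C37 j) (C38 j)) (Cinv j)) (fun j => KSCUPar P G (f j) (parA j) (parH j) (C37 j) (C38 j)) :=
  stepE4Pos_of_family_pos dB c35 (fun j => geo9Y (f j)) (fun j => (codingYx P G (f j) (C37 j) (C38 j)).bg)
    (fun j => KSC₇Par P G (f j) (parA j) (parH j) (C37 j) (C38 j)) (fun j => KSCUPar P G (f j) (parA j) (parH j) (C37 j) (C38 j))
    (fun j => KACU P G (f j) (OA j) (parB j) (C37 j) (C38 j)) (fun j => KACU P G (f j) (OA j) (parB j) (C37 j) (C38 j))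
    (fun j => pullS (codingYx P G (f j) (C37 j) (C38 j)) (Cinv j))
    (fun j => KSC₇Par P G (f j) (parA j) (parH j) (C37 j) (C38 j)) (fun j => KSCUPar P G (f j) (parA j) (parH j) (C37 j) (C38 j))
    (hin_KSCUPar_on_pos P f c35 G parA parH OA parB b ιB C37 C38 Cinv hι hG1 hM₂ hrepr dB)
    (fun Bε δ a hδ ha => ⟨0, 1, a, Bε, δ, one_pos, ha, le_rfl, hδ,
      fun j _ _ _ _ _ _ _ _ _ _ _ h => (e4Block_KSC₇Par_iff P G (f j) (parA j) (parH j) (C37 j) (C38 j) _).1 h⟩)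
    (stepE4Pos_of_e4Frame₃ (d := dB)
      ((e4Frame₃CodedOnSel P f c35 G parA b ιB C37 C38 hι hG1 dB M₂ hM₂ hrepr hcR Cq hCq hC37 MInv aInv aW hMInv haInv haW hparG hparC hunitG).swapGp
        (fun j => KSC₇Par P G (f j) (parA j) (parH j) (C37 j) (C38 j))
        (fun j _ _ c => (eBlock_KSC₇Par_iff P G (f j) (parA j) (parH j) (C37 j) (C38 j) c).trans (eBlock_KSC₆_iff P G (f j) (parA j) (C37 j) (C38 j) c).symm)
        (fun j _ _ c => e4Block_KSC₇Par_iff_KSC₆ P G (f j) (parA j) (parH j) (C37 j) (C38 j) c))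
      _ _)

/-- ★ **`StepKerPos` OF THE FRAME FAMILY `KSC₇Par` WITH THE RECORD's (3.48) KERNEL OF `C = CY parA (GpY parA)`** (any shared `GA`): `stepKerPos_of_cinvFrame₃` on
the (G′, C⁻¹) frame `cinvFrame₃CodedOn` AT `parA` RE-KEYED to `KSC₇Par` by `CinvFrame₃.swapGp`.  Displayed: the root frame's data, `hunitXG`, `hsym` — all at `parA`.
[cite: Balaban1985BackgroundPropagators, Thm 3.4 p.400, Thm 3.2 (3.48) p.398, (3.65)–(3.67) p.403, (3.57)–(3.59) pp.401–402; Balaban1984PropagatorsII, Lemma 2.1 p.234, (2.51) p.232] -/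
theorem stepKerPos_KSC₇ParG_cinv_on (hι : ∀ (j : J) (s : BlkY (f j).toKIdx), β (f j).toKIdx.hN (f j).toKIdx.D (f j).toKIdx.hk (ιB j s) = s)
    (hG1 : ∀ u : 𝔸ˣ, u ∈ G → ‖(u : 𝔸)‖ ≤ 1)
    (M₂ : ℝ) (hM₂ : 0 ≤ M₂) (hrepr : ∀ (v : 𝔸) (j : ι), |b.repr v j| ≤ M₂ * ‖v‖) (hcR : 0 < M₂ * ∑ j, ‖b j‖)
    (Cq : ℝ) (hCq : 0 ≤ Cq) (hC37 : ∀ j β' U a, C37 j β' U a → GVal G (f j).toKIdx U ∧ CplxLettersY G (f j) (parA j) (ιB j) Cq β' U a)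
    (MInv aInv aW : ℝ) (hMInv : 0 < MInv) (haInv : 0 < aInv) (haW : 0 < aW)
    (hparG : ∀ j (α₀ : ℝ) (U : CfgY 𝔸 (f j).toKIdx), MInv ≤ (geo9Y (f j)).M → 0 < α₀ → (geo9Y (f j)).M * α₀ ≤ aInv →
      (bg9YC 𝔸 G P (f j)).Reg335 c35 α₀ U → ∀ z w, parA j U z w ∈ G)
    (hparC : ∀ j β' U a, C37 j β' U a → ∀ z w, parA j U z w ∈ G)
    (hunitG : ∀ j (α₀ : ℝ) (U : CfgY 𝔸 (f j).toKIdx), MInv ≤ (geo9Y (f j)).M → 0 < α₀ → (geo9Y (f j)).M * α₀ ≤ aInv →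
      (bg9YC 𝔸 G P (f j)).Reg335 c35 α₀ U → IsUnit (deltaPrimeAY (f j).toKIdx (parA j) U))
    (hunitXG : ∀ j (α₀ : ℝ) (U : CfgY 𝔸 (f j).toKIdx), MInv ≤ (geo9Y (f j)).M → 0 < α₀ → (geo9Y (f j)).M * α₀ ≤ aInv →
      (bg9YC 𝔸 G P (f j)).Reg335 c35 α₀ U → IsUnit (XY (f j).toKIdx (parA j) (GpY (f j).toKIdx (parA j)) U))
    (hsym : ∀ j (U : CfgY 𝔸 (f j).toKIdx) (z w : SiteY (f j).toKIdx), parA j U z w = (parA j U w z)⁻¹)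
    (GA : ∀ j : J, B9.KernelFamily (geo9Y (f j)) (codingYx P G (f j) (C37 j) (C38 j)).bg) :
    StepKerPos (d + 1) c35 (fun j => geo9Y (f j)) (fun j => (codingYx P G (f j) (C37 j) (C38 j)).bg) (fun j => KSC₇Par P G (f j) (parA j) (parH j) (C37 j) (C38 j)) GA
      (fun j => pullS (codingYx P G (f j) (C37 j) (C38 j)) (CinvY P f G parA j)) (fun j => pullS (codingYx P G (f j) (C37 j) (C38 j)) (CinvY P f G parA j)) :=
  stepKerPos_of_cinvFrame₃ _ _ _ _ _ _ _ _
    ((cinvFrame₃CodedOnSel P f c35 G parA b ιB C37 C38 hι hG1 M₂ hM₂ hrepr hcR Cq hCq hC37 MInv aInv aW hMInv haInv haW hparG hparC hunitG hunitXG hsym).swapGp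
      (fun j => KSC₇Par P G (f j) (parA j) (parH j) (C37 j) (C38 j)) (fun j _ _ c => eBlock_KSC₇Par_iff P G (f j) (parA j) (parH j) (C37 j) (C38 j) c)) GA

/-- ★ **`StepKerPos` OF `(KSCUPar, KACU, C⁻¹(parA))` over the coded carriers — the (3.48) member** (the record's kernel of `C = CY parA (GpY parA)` read along the
decoding, shared input∕output): the (G′, C⁻¹) frame `cinvFrame₃CodedOn` AT `parA` RE-KEYED to `KSC₇Par` by `CinvFrame₃.swapGp`, its step `stepKerPos_of_cinvFrame₃`,
transported by `stepKerPos_of_family_pos` (`hin_KSCUPar_on_pos`; identity output).  Displayed beyond the root frame's data: `hunitXG` (`(Q′G′²Q′*)(U)` a unit) and the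
reversal law `hsym`, BOTH AT THE AVERAGING TRANSPORTER `parA`; no law of `parH`.
[cite: Balaban1985BackgroundPropagators, Thm 3.4 p.400, Thm 3.2 (3.48) p.398, (3.65)–(3.67) p.403, (3.57)–(3.59) pp.401–402, (3.21) p.394; Balaban1984PropagatorsII, Lemma 2.1 p.234, (2.51) p.232] -/
theorem stepKerPos_KSCUParG_on (hι : ∀ (j : J) (s : BlkY (f j).toKIdx), β (f j).toKIdx.hN (f j).toKIdx.D (f j).toKIdx.hk (ιB j s) = s)
    (hG1 : ∀ u : 𝔸ˣ, u ∈ G → ‖(u : 𝔸)‖ ≤ 1)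
    (M₂ : ℝ) (hM₂ : 0 ≤ M₂) (hrepr : ∀ (v : 𝔸) (j : ι), |b.repr v j| ≤ M₂ * ‖v‖) (hcR : 0 < M₂ * ∑ j, ‖b j‖)
    (Cq : ℝ) (hCq : 0 ≤ Cq) (hC37 : ∀ j β' U a, C37 j β' U a → GVal G (f j).toKIdx U ∧ CplxLettersY G (f j) (parA j) (ιB j) Cq β' U a)
    (MInv aInv aW : ℝ) (hMInv : 0 < MInv) (haInv : 0 < aInv) (haW : 0 < aW)
    (hparG : ∀ j (α₀ : ℝ) (U : CfgY 𝔸 (f j).toKIdx), MInv ≤ (geo9Y (f j)).M → 0 < α₀ → (geo9Y (f j)).M * α₀ ≤ aInv →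
      (bg9YC 𝔸 G P (f j)).Reg335 c35 α₀ U → ∀ z w, parA j U z w ∈ G)
    (hparC : ∀ j β' U a, C37 j β' U a → ∀ z w, parA j U z w ∈ G)
    (hunitG : ∀ j (α₀ : ℝ) (U : CfgY 𝔸 (f j).toKIdx), MInv ≤ (geo9Y (f j)).M → 0 < α₀ → (geo9Y (f j)).M * α₀ ≤ aInv →
      (bg9YC 𝔸 G P (f j)).Reg335 c35 α₀ U → IsUnit (deltaPrimeAY (f j).toKIdx (parA j) U))
    (hunitXG : ∀ j (α₀ : ℝ) (U : CfgY 𝔸 (f j).toKIdx), MInv ≤ (geo9Y (f j)).M → 0 < α₀ → (geo9Y (f j)).M * α₀ ≤ aInv →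
      (bg9YC 𝔸 G P (f j)).Reg335 c35 α₀ U → IsUnit (XY (f j).toKIdx (parA j) (GpY (f j).toKIdx (parA j)) U))
    (hsym : ∀ j (U : CfgY 𝔸 (f j).toKIdx) (z w : SiteY (f j).toKIdx), parA j U z w = (parA j U w z)⁻¹) :
    StepKerPos (d + 1) c35 (fun j => geo9Y (f j)) (fun j => (codingYx P G (f j) (C37 j) (C38 j)).bg)
      (fun j => KSCUPar P G (f j) (parA j) (parH j) (C37 j) (C38 j)) (fun j => KACU P G (f j) (OA j) (parB j) (C37 j) (C38 j))
      (fun j => pullS (codingYx P G (f j) (C37 j) (C38 j)) (CinvY P f G parA j)) (fun j => pullS (codingYx P G (f j) (C37 j) (C38 j)) (CinvY P f G parA j)) :=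
  stepKerPos_of_family_pos (d + 1) c35 (fun j => geo9Y (f j)) (fun j => (codingYx P G (f j) (C37 j) (C38 j)).bg)
    (fun j => KSC₇Par P G (f j) (parA j) (parH j) (C37 j) (C38 j)) (fun j => KSCUPar P G (f j) (parA j) (parH j) (C37 j) (C38 j))
    (fun j => KACU P G (f j) (OA j) (parB j) (C37 j) (C38 j)) (fun j => KACU P G (f j) (OA j) (parB j) (C37 j) (C38 j))
    (fun j => pullS (codingYx P G (f j) (C37 j) (C38 j)) (CinvY P f G parA j))
    (hin_KSCUPar_on_pos P f c35 G parA parH OA parB b ιB C37 C38 (CinvY P f G parA) hι hG1 hM₂ hrepr (d + 1))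
    (fun j => pullS (codingYx P G (f j) (C37 j) (C38 j)) (CinvY P f G parA j)) (fun j => pullS (codingYx P G (f j) (C37 j) (C38 j)) (CinvY P f G parA j))
    (fun B δ a hB hδ ha => ⟨0, 1, a, B, δ, one_pos, ha, le_rfl, hB, hδ, fun _ _ _ _ _ _ _ _ _ _ _ _ hK => hK⟩)
    (stepKerPos_KSC₇ParG_cinv_on P f c35 G parA parH b ιB C37 C38 hι hG1 M₂ hM₂ hrepr hcR Cq hCq hC37 MInv aInv aW hMInv haInv haW hparG hparC hunitG hunitXG
      hsym _)

/-- ★ **`StepAnalyticPos1` OF THE TWO-TRANSPORTER READING at the coded pin `IsAnKY parA`** (input families `(KSCUPar, KACU, pullS Cinv)`): the analytic-extension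
frame `anFrame₂CodedOn` AT `KSC₇Par`, its step `stepAnalyticPos1_of_anFrame₂`, transported by `stepPos_of_family_pos` (`hin_KSCUPar_on_pos`; the pin does not read the
family).  Laws displayed at `parA` only. [cite: Balaban1985BackgroundPropagators, Thm 3.4 p.400, (3.60)–(3.64) p.402, (3.35)–(3.37) p.396; Balaban1984PropagatorsII, Lemma 2.1 p.234] -/
theorem stepAnalyticPos1_KSCUParG_on (hι : ∀ (j : J) (s : BlkY (f j).toKIdx), β (f j).toKIdx.hN (f j).toKIdx.D (f j).toKIdx.hk (ιB j s) = s)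
    (hG1 : ∀ u : 𝔸ˣ, u ∈ G → ‖(u : 𝔸)‖ ≤ 1)
    (dB : ℕ) (M₂ : ℝ) (hM₂ : 0 ≤ M₂) (hrepr : ∀ (v : 𝔸) (j : ι), |b.repr v j| ≤ M₂ * ‖v‖) (hcR : 0 < M₂ * ∑ j, ‖b j‖)
    (Cq : ℝ) (hCq : 0 ≤ Cq) (hC37 : ∀ j β' U a, C37 j β' U a → GVal G (f j).toKIdx U ∧ CplxLettersY G (f j) (parA j) (ιB j) Cq β' U a)
    (MInv aInv aW : ℝ) (hMInv : 0 < MInv) (haInv : 0 < aInv) (haW : 0 < aW)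
    (hparG : ∀ j (α₀ : ℝ) (U : CfgY 𝔸 (f j).toKIdx), MInv ≤ (geo9Y (f j)).M → 0 < α₀ → (geo9Y (f j)).M * α₀ ≤ aInv →
      (bg9YC 𝔸 G P (f j)).Reg335 c35 α₀ U → ∀ z w, parA j U z w ∈ G)
    (hparC : ∀ j β' U a, C37 j β' U a → ∀ z w, parA j U z w ∈ G)
    (hunitG : ∀ j (α₀ : ℝ) (U : CfgY 𝔸 (f j).toKIdx), MInv ≤ (geo9Y (f j)).M → 0 < α₀ → (geo9Y (f j)).M * α₀ ≤ aInv →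
      (bg9YC 𝔸 G P (f j)).Reg335 c35 α₀ U → IsUnit (deltaPrimeAY (f j).toKIdx (parA j) U)) :
    StepAnalyticPos1 dB c35 (fun j => geo9Y (f j)) (fun j => (codingYx P G (f j) (C37 j) (C38 j)).bg)
      (fun j => KSCUPar P G (f j) (parA j) (parH j) (C37 j) (C38 j)) (fun j => KACU P G (f j) (OA j) (parB j) (C37 j) (C38 j))
      (fun j => pullS (codingYx P G (f j) (C37 j) (C38 j)) (Cinv j))
      (fun j => IsAnKY P G (f j) (parA j) b (C37 j) (C38 j)) (fun j => KSCUPar P G (f j) (parA j) (parH j) (C37 j) (C38 j)) := by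
  refine stepPos_of_family_pos dB c35 (fun j => geo9Y (f j)) (fun j => (codingYx P G (f j) (C37 j) (C38 j)).bg)
    (fun j => KSC₇Par P G (f j) (parA j) (parH j) (C37 j) (C38 j)) (fun j => KSCUPar P G (f j) (parA j) (parH j) (C37 j) (C38 j))
    (fun j => KACU P G (f j) (OA j) (parB j) (C37 j) (C38 j)) (fun j => KACU P G (f j) (OA j) (parB j) (C37 j) (C38 j))
    (fun j => pullS (codingYx P G (f j) (C37 j) (C38 j)) (Cinv j))
    (C₁ := PUnit) (C₂ := PUnit) (pos₁ := fun _ => True) (pos₂ := fun _ => True)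
    (Out₁ := fun _ j V α => IsAnKY P G (f j) (parA j) b (C37 j) (C38 j) (KSC₇Par P G (f j) (parA j) (parH j) (C37 j) (C38 j)) V α)
    (Out₂ := fun _ j V α => IsAnKY P G (f j) (parA j) b (C37 j) (C38 j) (KSCUPar P G (f j) (parA j) (parH j) (C37 j) (C38 j)) V α)
    (hin_KSCUPar_on_pos P f c35 G parA parH OA parB b ιB C37 C38 Cinv hι hG1 hM₂ hrepr dB)
    (fun c hc a ha => ⟨0, 1, a, c, one_pos, ha, le_rfl, hc, fun _ _ _ _ _ _ _ _ _ _ h => h⟩)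
    (stepAnalyticPos1_of_anFrame₂ (d := dB)
      (anFrame₂CodedOnSel P f c35 G b C37 C38 parA ιB (fun j => KSC₇Par P G (f j) (parA j) (parH j) (C37 j) (C38 j)) hι hG1 dB M₂ hM₂ hrepr Cq hCq hC37
        (M₂ * ∑ j, ‖b j‖) hcR (fun B _ => (M₂ * ∑ j, ‖b j‖) * B + 1) (fun B _ hB _ => by positivity) (fun δ => δ) (fun δ hδ => hδ)
        MInv aInv aW hMInv haInv haW hparG hparC hunitG (fun j => read342Y_KSC₇Par P G (f j) (parA j) (parH j) b (ιB j) (C37 j) (C38 j) (hι j) M₂ hM₂ hrepr c35 MInv aInv)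
        (fun j => write342Y_KSC₇Par P G (f j) (parA j) (parH j) b (ιB j) (C37 j) (C38 j) (hι j) M₂ hM₂ hrepr aW fun β' U a h => (hC37 j β' U a h).1))
      _ _)

/-- ★ **`StepAnalyticPos` (both halves) OF `(KSCUPar, KACU, C⁻¹)` at `IsAnKY parA`** — the pin ignores the family, so the `KACU` half is the `KSCUPar` half.
[cite: Balaban1985BackgroundPropagators, Thm 3.4 p.400, (3.62)–(3.64) p.402, (3.86) p.407] -/
theorem stepAnalyticPos_KSCUParG_on (hι : ∀ (j : J) (s : BlkY (f j).toKIdx), β (f j).toKIdx.hN (f j).toKIdx.D (f j).toKIdx.hk (ιB j s) = s)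
    (hG1 : ∀ u : 𝔸ˣ, u ∈ G → ‖(u : 𝔸)‖ ≤ 1)
    (dB : ℕ) (M₂ : ℝ) (hM₂ : 0 ≤ M₂) (hrepr : ∀ (v : 𝔸) (j : ι), |b.repr v j| ≤ M₂ * ‖v‖) (hcR : 0 < M₂ * ∑ j, ‖b j‖)
    (Cq : ℝ) (hCq : 0 ≤ Cq) (hC37 : ∀ j β' U a, C37 j β' U a → GVal G (f j).toKIdx U ∧ CplxLettersY G (f j) (parA j) (ιB j) Cq β' U a)
    (MInv aInv aW : ℝ) (hMInv : 0 < MInv) (haInv : 0 < aInv) (haW : 0 < aW)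
    (hparG : ∀ j (α₀ : ℝ) (U : CfgY 𝔸 (f j).toKIdx), MInv ≤ (geo9Y (f j)).M → 0 < α₀ → (geo9Y (f j)).M * α₀ ≤ aInv →
      (bg9YC 𝔸 G P (f j)).Reg335 c35 α₀ U → ∀ z w, parA j U z w ∈ G)
    (hparC : ∀ j β' U a, C37 j β' U a → ∀ z w, parA j U z w ∈ G)
    (hunitG : ∀ j (α₀ : ℝ) (U : CfgY 𝔸 (f j).toKIdx), MInv ≤ (geo9Y (f j)).M → 0 < α₀ → (geo9Y (f j)).M * α₀ ≤ aInv →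
      (bg9YC 𝔸 G P (f j)).Reg335 c35 α₀ U → IsUnit (deltaPrimeAY (f j).toKIdx (parA j) U)) :
    StepAnalyticPos dB c35 (fun j => geo9Y (f j)) (fun j => (codingYx P G (f j) (C37 j) (C38 j)).bg)
      (fun j => KSCUPar P G (f j) (parA j) (parH j) (C37 j) (C38 j)) (fun j => KACU P G (f j) (OA j) (parB j) (C37 j) (C38 j))
      (fun j => pullS (codingYx P G (f j) (C37 j) (C38 j)) (Cinv j))
      (fun j => IsAnKY P G (f j) (parA j) b (C37 j) (C38 j)) := by
  have h := stepAnalyticPos1_KSCUParG_on P f c35 G parA parH OA parB b ιB C37 C38 Cinv hι hG1 dB M₂ hM₂ hrepr hcR Cq hCq hC37 MInv aInv aW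
    hMInv haInv haW hparG hparC hunitG
  exact stepAnalyticPos_of_halves h h

end EGlobE4KerAn

/-! ## §2 The (3.46) member -/

section L2

open Literature.MathematicalPhysics.QuantumFieldTheory.Balaban1983to89.B9SectBCodedClassR (RegExtraY bg9YC)
open Literature.MathematicalPhysics.QuantumFieldTheory.Balaban1983to89.B9SectBCodedFamiliesUParH
open B6Ineq2142KLevelV1 (β)
open B6RandomWalk (Ineq261)
open B9Thm34Ext (toB6)
open B9Ineq347 (ScaleTransfer)
open B9FromB6 (EBlock L2Block GlobBlock)
open B9SectBCodedCarrier (CCfg Coding pullK pullS)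
open B9Eq360DeltaPrimeAY (AfldY)
open B9PinMembersKLevelV1 (MemberY geo9Y bg9Y)
open B9SectBGpLettersY (GVal decY)
open B9SectBGpFrameCodedYR (codingYx Read342Y Write342Y)
open B9SectBGpFrameCodedY (CplxLettersY)
open B9SectBGpReadingsYR (KSC read342Y_KSC write342Y_KSC)
open B9SectBGpReadingsY (baseY)
open B9SectBCodedReadingsUR (KSCU KACU)
open B9SectBCodedReadingsUParH (KSCUPar)
open B9SectBStepsKSCUR (KACU_members_base ineq342_346_347_congr KSCU_members_base)
open B9SectBStepsKSCUBlocksR (KACU_holder_nonneg l2Block_KSCU_of_KSC₃)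
open B9SectBGpTransferInYR (ineq343_345_congr ineq342_346_347_mono KSC_members_base pullK_members_base)
open B9SectBGpTransferOutYR (ineq342_346_347_weaken ineq343_345_antitone)
open B9SectBGpTransferOutY (kernelFamilyS_members_nonneg)
open B9SectBCodedChainGlobR (KSC₂)
open B9SectBL2DictionaryYR (KSC₃ read342Y_KSC₃ write342Y_KSC₃ readL2_KSC₃ readL2_two_KSC₃ readL2_three_KSC₃ readL2_four_KSC₃ readL2_five_KSC₃ writeL2_zero_KSC₃ writeL2_one_KSC₃
  writeL2_two_KSC₃ writeL2_three_KSC₃ writeL2_four_KSC₃ writeL2_five_KSC₃)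
open B9SectBL2SecondOrderYR (l2Block_KSC₃_base_of_record)
open B9SectBL2SecondOrderY (PlaqLawY cross2ConstL2 cross2ConstL2_nonneg)
open B9SectBL2TransferInY (crossConstL2 crossConstL2_nonneg)
open B9SectBCodedChainL2R (thms_mono_B₀)
open B9SectBCodedChainL2 (exists_thresholds_L2 l2Block_max_zero l2Block_weaken)
open B9SectBStepL2FamilyTransferPos (stepL2Pos_of_family_pos)
open B9SectBStepWhole (StepL2nPos StepL2Pos stepL2Pos_of_members)
open B9GeoNbrCountKLevelV1 (exists_card_nbr_geo9Y_le_of_M)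
open B9RWSumsReadsNbr (nbr)
open B9GeoNormsKLevelModelSignsV1 (modelSignsOn_geo9K)
open Node00 (SiteY BlkY IBondY CfgY SiteParY BondParY BondOpY deltaPrimeAY kernelFamilyS kernelFamilyB GpY)
open Literature.MathematicalPhysics.QuantumFieldTheory.Balaban1983to89.B9SectBParSelY
open Literature.MathematicalPhysics.QuantumFieldTheory.Balaban1983to89.B9SectBFramesSelY (gpFrame₂CodedOnSel anFrame₂CodedOnSel cinvFrame₃CodedOnSel e4Frame₃CodedOnSel)
open Literature.MathematicalPhysics.QuantumFieldTheory.Balaban1983to89.B9SectBCodedFamiliesUParH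
open Literature.MathematicalPhysics.QuantumFieldTheory.Balaban1983to89.B9SectBL2StepUParH (KSC₃Par KSC₃Par_members KSC₃Par_members₇ eBlock_KSC₃Par_iff l2Block_KSC₃Par_iff read342Y_KSC₃Par write342Y_KSC₃Par hin_KSCUPar₃_on_pos houtL2_KSCUPar_on)
open Literature.MathematicalPhysics.QuantumFieldTheory.Balaban1983to89.B9SectBH1StepUParH (h1_transfer_KSC₇Par)
open Literature.MathematicalPhysics.QuantumFieldTheory.Balaban1983to89.B9SectBH2StepUParH (h2_transfer_KSC₇Par)

variable [NormOneClass 𝔸] [FiniteDimensional ℝ 𝔸] {J : Type} (f : J → MemberY d ℓ hd hL b₀ b₁ Mstar)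
  (c35 : ℝ) (G : Subgroup 𝔸ˣ) {ι : Type} [Fintype ι] [DecidableEq ι] (b : Module.Basis ι ℝ 𝔸)
  [∀ x : MemberY d ℓ hd hL b₀ b₁ Mstar, Fintype (geo9Y x).Site] [∀ x : MemberY d ℓ hd hL b₀ b₁ Mstar, DecidableEq (geo9Y x).Site]
  [∀ x : MemberY d ℓ hd hL b₀ b₁ Mstar, Nonempty (geo9Y x).Site]
  (C37 C38 : ∀ j : J, ℝ → CfgY 𝔸 (f j).toKIdx → AfldY 𝔸 (f j).toKIdx → Prop)
  (parA parH : ∀ j : J, SiteParY 𝔸 (f j).toKIdx) (OA : ∀ j : J, BondOpY 𝔸 (f j).toKIdx) (parB : ∀ j : J, BondParY 𝔸 (f j).toKIdx)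
  (ιB : ∀ j : J, BlkY (f j).toKIdx → IBondY (f j).toKIdx)
  (Cinv : ∀ j : J, B9.SiteKernel (geo9Y (f j)) (bg9YC 𝔸 G P (f j)))

/-- ★ **THE `L²` FRAME OVER THE CODED CARRIERS OF A SUBFAMILY AT `KSC₃Par parA parH`** (dag-n06-c g9's `B9SectBL2DictionaryY.l2Frame₂CodedOn` re-keyed: the root
frame `gpFrame₂CodedOn` at `parA` with the laws `hparG hparC hunitG hC37` (GUARDED by (3.35)∕(3.37)) at `parA`, the (3.42) dictionaries `read342Y ∕ write342Y_KSC₃Par`, the `L²` constant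
`c_L = √|ι|·M₂·Σ‖b_j‖`, and the `L²` read∕write dictionaries of `KSC₃ parA` (`readL2_KSC₃`, `writeL2_zero ∕ one_KSC₃`) bridged by `l2Block_KSC₃Par_iff` and the
definitional equality of the `l2` members). [cite: Balaban1985BackgroundPropagators, Thm 3.1 (3.46) p.398, Thm 3.4 p.400, p.403 l.1–9; Balaban1984PropagatorsII, Prop. 2.6 (2.140)–(2.141) p.247, (2.51) p.232] -/
noncomputable def l2Frame₂CodedOnParSel (hι : ∀ (j : J) (s : BlkY (f j).toKIdx), β (f j).toKIdx.hN (f j).toKIdx.D (f j).toKIdx.hk (ιB j s) = s)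
    (hG1 : ∀ u : 𝔸ˣ, u ∈ G → ‖(u : 𝔸)‖ ≤ 1)
    (dB : ℕ) (M₂ : ℝ) (hM₂ : 0 ≤ M₂) (hrepr : ∀ (v : 𝔸) (j : ι), |b.repr v j| ≤ M₂ * ‖v‖) (hcR : 0 < M₂ * ∑ j, ‖b j‖)
    (hcL : 0 < Real.sqrt (Fintype.card ι) * M₂ * ∑ j, ‖b j‖)
    (Cq : ℝ) (hCq : 0 ≤ Cq) (hC37 : ∀ j β' U a, C37 j β' U a → GVal G (f j).toKIdx U ∧ CplxLettersY G (f j) (parA j) (ιB j) Cq β' U a)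
    (MInv aInv aW : ℝ) (hMInv : 0 < MInv) (haInv : 0 < aInv) (haW : 0 < aW)
    (hparG : ∀ j (α₀ : ℝ) (U : CfgY 𝔸 (f j).toKIdx), MInv ≤ (geo9Y (f j)).M → 0 < α₀ → (geo9Y (f j)).M * α₀ ≤ aInv →
      (bg9YC 𝔸 G P (f j)).Reg335 c35 α₀ U → ∀ z w, parA j U z w ∈ G)
    (hparC : ∀ j β' U a, C37 j β' U a → ∀ z w, parA j U z w ∈ G)
    (hunitG : ∀ j (α₀ : ℝ) (U : CfgY 𝔸 (f j).toKIdx), MInv ≤ (geo9Y (f j)).M → 0 < α₀ → (geo9Y (f j)).M * α₀ ≤ aInv →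
      (bg9YC 𝔸 G P (f j)).Reg335 c35 α₀ U → IsUnit (deltaPrimeAY (f j).toKIdx (parA j) U)) :
    B9SectBL2StepAtLettersV2.L2Frame₂ c35 (fun j => geo9Y (f j)) (fun j => (codingYx P G (f j) (C37 j) (C38 j)).bg)
      (fun j => KSC₃Par P G (f j) (parA j) (parH j) (C37 j) (C38 j)) b (Fin (d + 1)) (fun j => SiteY (f j).toKIdx) :=
  { gpFrame₂CodedOnSel P f c35 G b C37 C38 parA ιB (fun j => KSC₃Par P G (f j) (parA j) (parH j) (C37 j) (C38 j)) hι hG1 dB M₂ hM₂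
      hrepr Cq hCq hC37 (M₂ * ∑ j, ‖b j‖) hcR (fun B _ => (M₂ * ∑ j, ‖b j‖) * B + 1) (fun B _ hB _ => by positivity) (fun δ => δ) (fun δ hδ => hδ)
      MInv aInv aW hMInv haInv haW hparG hparC hunitG (fun j => read342Y_KSC₃Par P G (f j) (parA j) (parH j) (C37 j) (C38 j) b (ιB j) (hι j) M₂ hM₂ hrepr c35 MInv aInv)
      (fun j => write342Y_KSC₃Par P G (f j) (parA j) (parH j) (C37 j) (C38 j) b (ιB j) (hι j) M₂ hM₂ hrepr aW fun β' U a h => (hC37 j β' U a h).1) with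
    cL := Real.sqrt (Fintype.card ι) * M₂ * ∑ j, ‖b j‖
    wL := fun B _ => (Real.sqrt (Fintype.card ι) * M₂ * ∑ j, ‖b j‖) * B + 1
    wLδ := fun δ => δ
    cL_pos := hcL
    wL_pos := fun B _ hB _ => by positivity
    wLδ_pos := fun δ hδ => hδ
    readL2 := fun j α₀ c B₀ δ hM hα₀ hMa hreg hB₀ _ hL2 => by
      obtain ⟨U, rfl, hU⟩ := (codingYx P G (f j) (C37 j) (C38 j)).exists_of_bg_Reg335 hreg
      have hR : InRegY G (f j).toKIdx (parA j) U := ⟨hU.1.1, hparG j α₀ U hM hα₀ hMa hU⟩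
      dsimp only [gpFrame₂CodedOnSel]
      erw [parSelC_base_of_inRegY G (f j).toKIdx (parA j) hR]
      exact readL2_KSC₃ P G (f j) (parA j) (C37 j) (C38 j) b (ιB j) (hι j) hM₂ hrepr hU.1.1 hB₀.le
        ((l2Block_KSC₃Par_iff P G (f j) (parA j) (parH j) (C37 j) (C38 j) _).1 hL2)
    writeL2_0 := fun j c c' α₁ B δ _ _ h37 hB _ hG lam h y y' hc hs => by
      obtain ⟨U, a, rfl, rfl, hC⟩ := (codingYx P G (f j) (C37 j) (C38 j)).exists_of_bg_Cplx337 h37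
      have hR : InRegY G (f j).toKIdx (parA j) U := ⟨(hC37 j _ U a hC).1, hparC j _ U a hC⟩
      dsimp only [gpFrame₂CodedOnSel] at hG
      erw [parSelC_base_of_inRegY G (f j).toKIdx (parA j) hR] at hG
      exact writeL2_zero_KSC₃ P G (f j) (parA j) (C37 j) (C38 j) b (ιB j) (hι j) hM₂ hrepr U a hB hG lam h y y' hc hs
    writeL2_1 := fun j c c' α₁ B δ _ _ h37 hB _ hDG lam h y y' hc hs => by
      obtain ⟨U, a, rfl, rfl, hC⟩ := (codingYx P G (f j) (C37 j) (C38 j)).exists_of_bg_Cplx337 h37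
      have hR : InRegY G (f j).toKIdx (parA j) U := ⟨(hC37 j _ U a hC).1, hparC j _ U a hC⟩
      dsimp only [gpFrame₂CodedOnSel] at hDG
      erw [parSelC_base_of_inRegY G (f j).toKIdx (parA j) hR] at hDG
      exact writeL2_one_KSC₃ P G (f j) (parA j) (C37 j) (C38 j) b (ιB j) (hι j) hM₂ hrepr (hC37 j _ U a hC).1 a hB hDG lam h y y' hc hs }

/-- ★★ **THE POSITIVE-INPUT (3.46) BLOCK-STEP OF THE TWO-TRANSPORTER `L²` FRAME FAMILY `KSC₃Par parA parH`, MEMBER BY MEMBER, ON A SUBFAMILY** (all six members), from the letters-level frames over the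
coded carrier (`l2Frame₂CodedOn`) and the six tautological read/write fields of the augmented readings; any `GA`, `Cinv`.
[cite: Balaban1985BackgroundPropagators, Thm 3.1 (3.46) p.398, Thm 3.4 p.400, (3.63)–(3.67) pp.402–403, p.403 l.1–9; Balaban1984PropagatorsII, Prop. 2.6 (2.140)–(2.141) p.247, Lemma 2.1 p.234] -/
theorem stepL2nPos_KSC₃ParG_on (hι : ∀ (j : J) (s : BlkY (f j).toKIdx), β (f j).toKIdx.hN (f j).toKIdx.D (f j).toKIdx.hk (ιB j s) = s)
    (hG1 : ∀ u : 𝔸ˣ, u ∈ G → ‖(u : 𝔸)‖ ≤ 1)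
    (dB : ℕ) (M₂ : ℝ) (hM₂ : 0 ≤ M₂) (hrepr : ∀ (v : 𝔸) (j : ι), |b.repr v j| ≤ M₂ * ‖v‖) (hcR : 0 < M₂ * ∑ j, ‖b j‖)
    (hcL : 0 < Real.sqrt (Fintype.card ι) * M₂ * ∑ j, ‖b j‖)
    (Cq : ℝ) (hCq : 0 ≤ Cq) (hC37 : ∀ j β' U a, C37 j β' U a → GVal G (f j).toKIdx U ∧ CplxLettersY G (f j) (parA j) (ιB j) Cq β' U a)
    (MInv aInv aW : ℝ) (hMInv : 0 < MInv) (haInv : 0 < aInv) (haW : 0 < aW)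
    (hparG : ∀ j (α₀ : ℝ) (U : CfgY 𝔸 (f j).toKIdx), MInv ≤ (geo9Y (f j)).M → 0 < α₀ → (geo9Y (f j)).M * α₀ ≤ aInv →
      (bg9YC 𝔸 G P (f j)).Reg335 c35 α₀ U → ∀ z w, parA j U z w ∈ G)
    (hparC : ∀ j β' U a, C37 j β' U a → ∀ z w, parA j U z w ∈ G)
    (hunitG : ∀ j (α₀ : ℝ) (U : CfgY 𝔸 (f j).toKIdx), MInv ≤ (geo9Y (f j)).M → 0 < α₀ → (geo9Y (f j)).M * α₀ ≤ aInv →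
      (bg9YC 𝔸 G P (f j)).Reg335 c35 α₀ U → IsUnit (deltaPrimeAY (f j).toKIdx (parA j) U))
    (GA : ∀ j : J, B9.KernelFamily (geo9Y (f j)) (codingYx P G (f j) (C37 j) (C38 j)).bg)
    (Cinv : ∀ j : J, B9.SiteKernel (geo9Y (f j)) (codingYx P G (f j) (C37 j) (C38 j)).bg) (n : Fin 6) :
    StepL2nPos dB c35 (fun j => geo9Y (f j)) (fun j => (codingYx P G (f j) (C37 j) (C38 j)).bg) (fun j => KSC₃Par P G (f j) (parA j) (parH j) (C37 j) (C38 j)) GA Cinv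
      (fun j => KSC₃Par P G (f j) (parA j) (parH j) (C37 j) (C38 j)) n := by
  set F := l2Frame₂CodedOnParSel P f c35 G b C37 C38 parA parH ιB hι hG1 dB M₂ hM₂ hrepr hcR hcL Cq hCq hC37 MInv aInv aW hMInv haInv haW hparG hparC hunitG with hF
  -- the six tautological fields of the augmented readings, in the frames' binder shapes
  have r2 : ∀ j (α₀ : ℝ) (c : (codingYx P G (f j) (C37 j) (C38 j)).bg.Cfg) (B₀ δ : ℝ), F.MInv ≤ (geo9Y (f j)).M → 0 < α₀ → (geo9Y (f j)).M * α₀ ≤ F.aInv →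
      (codingYx P G (f j) (C37 j) (C38 j)).bg.Reg335 c35 α₀ c → 0 < B₀ → 0 < δ → B9FromB6.L2Block (KSC₃Par P G (f j) (parA j) (parH j) (C37 j) (C38 j)) B₀ δ c →
      ∀ k : Fin (d + 1) ⊕ Fin (d + 1), B6RandomWalkL2.HasL2Majorant (g := B9Thm34Ext.toB6 (geo9Y (f j)) (F.Rr j) (F.Hp j))
        (fun p : SiteY (f j).toKIdx × ι => F.blk j p.1)
        (F.Gop j c * B9Eq352DivFormLetters.conj b (B9Eq352GradLetters.diffLetter (F.T j) (F.coord j c) ((((geo9Y (f j)).eta : ℂ))⁻¹) k))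
        (fun a a' => F.cL * B₀ * (geo9Y (f j)).len a * Real.exp (-(δ * (geo9Y (f j)).dist a a'))) := by
    intro j α₀ c B₀ δ hM hα₀ hMa hreg hB₀ _ hL2 k
    obtain ⟨U, rfl, hU⟩ := (codingYx P G (f j) (C37 j) (C38 j)).exists_of_bg_Reg335 hreg
    have hR : InRegY G (f j).toKIdx (parA j) U := ⟨hU.1.1, hparG j α₀ U hM hα₀ hMa hU⟩
    rw [hF]
    dsimp only [l2Frame₂CodedOnParSel, gpFrame₂CodedOnSel]
    erw [parSelC_base_of_inRegY G (f j).toKIdx (parA j) hR]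
    exact readL2_two_KSC₃ P G (f j) (parA j) (C37 j) (C38 j) b (ιB j) (hι j) hM₂ hrepr hU.1.1 hB₀.le
      ((l2Block_KSC₃Par_iff P G (f j) (parA j) (parH j) (C37 j) (C38 j) _).1 hL2) k
  have r3 : ∀ j (α₀ : ℝ) (c : (codingYx P G (f j) (C37 j) (C38 j)).bg.Cfg) (B₀ δ : ℝ), F.MInv ≤ (geo9Y (f j)).M → 0 < α₀ → (geo9Y (f j)).M * α₀ ≤ F.aInv →
      (codingYx P G (f j) (C37 j) (C38 j)).bg.Reg335 c35 α₀ c → 0 < B₀ → 0 < δ → B9FromB6.L2Block (KSC₃Par P G (f j) (parA j) (parH j) (C37 j) (C38 j)) B₀ δ c →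
      ∀ k l : Fin (d + 1) ⊕ Fin (d + 1), B6RandomWalkL2.HasL2Majorant (g := B9Thm34Ext.toB6 (geo9Y (f j)) (F.Rr j) (F.Hp j))
        (fun p : SiteY (f j).toKIdx × ι => F.blk j p.1)
        (B9Eq352DivFormLetters.conj b (B9Eq352GradLetters.diffLetter (F.T j) (F.coord j c) ((((geo9Y (f j)).eta : ℂ))⁻¹) k) *
          B9Eq352DivFormLetters.conj b (B9Eq352GradLetters.diffLetter (F.T j) (F.coord j c) ((((geo9Y (f j)).eta : ℂ))⁻¹) l) * F.Gop j c)
        (fun a a' => F.cL * B₀ * 1 * Real.exp (-(δ * (geo9Y (f j)).dist a a'))) := by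
    intro j α₀ c B₀ δ hM hα₀ hMa hreg hB₀ _ hL2 k l
    obtain ⟨U, rfl, hU⟩ := (codingYx P G (f j) (C37 j) (C38 j)).exists_of_bg_Reg335 hreg
    have hR : InRegY G (f j).toKIdx (parA j) U := ⟨hU.1.1, hparG j α₀ U hM hα₀ hMa hU⟩
    rw [hF]
    dsimp only [l2Frame₂CodedOnParSel, gpFrame₂CodedOnSel]
    erw [parSelC_base_of_inRegY G (f j).toKIdx (parA j) hR]
    exact readL2_three_KSC₃ P G (f j) (parA j) (C37 j) (C38 j) b (ιB j) (hι j) hM₂ hrepr hU.1.1 hB₀.le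
      ((l2Block_KSC₃Par_iff P G (f j) (parA j) (parH j) (C37 j) (C38 j) _).1 hL2) k l
  have r4 : ∀ j (α₀ : ℝ) (c : (codingYx P G (f j) (C37 j) (C38 j)).bg.Cfg) (B₀ δ : ℝ), F.MInv ≤ (geo9Y (f j)).M → 0 < α₀ → (geo9Y (f j)).M * α₀ ≤ F.aInv →
      (codingYx P G (f j) (C37 j) (C38 j)).bg.Reg335 c35 α₀ c → 0 < B₀ → 0 < δ → B9FromB6.L2Block (KSC₃Par P G (f j) (parA j) (parH j) (C37 j) (C38 j)) B₀ δ c →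
      ∀ k l : Fin (d + 1) ⊕ Fin (d + 1), B6RandomWalkL2.HasL2Majorant (g := B9Thm34Ext.toB6 (geo9Y (f j)) (F.Rr j) (F.Hp j))
        (fun p : SiteY (f j).toKIdx × ι => F.blk j p.1)
        (B9Eq352DivFormLetters.conj b (B9Eq352GradLetters.diffLetter (F.T j) (F.coord j c) ((((geo9Y (f j)).eta : ℂ))⁻¹) k) * F.Gop j c *
          B9Eq352DivFormLetters.conj b (B9Eq352GradLetters.diffLetter (F.T j) (F.coord j c) ((((geo9Y (f j)).eta : ℂ))⁻¹) l))
        (fun a a' => F.cL * B₀ * 1 * Real.exp (-(δ * (geo9Y (f j)).dist a a'))) := by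
    intro j α₀ c B₀ δ hM hα₀ hMa hreg hB₀ _ hL2 k l
    obtain ⟨U, rfl, hU⟩ := (codingYx P G (f j) (C37 j) (C38 j)).exists_of_bg_Reg335 hreg
    have hR : InRegY G (f j).toKIdx (parA j) U := ⟨hU.1.1, hparG j α₀ U hM hα₀ hMa hU⟩
    rw [hF]
    dsimp only [l2Frame₂CodedOnParSel, gpFrame₂CodedOnSel]
    erw [parSelC_base_of_inRegY G (f j).toKIdx (parA j) hR]
    exact readL2_four_KSC₃ P G (f j) (parA j) (C37 j) (C38 j) b (ιB j) (hι j) hM₂ hrepr hU.1.1 hB₀.le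
      ((l2Block_KSC₃Par_iff P G (f j) (parA j) (parH j) (C37 j) (C38 j) _).1 hL2) k l
  have r5 : ∀ j (α₀ : ℝ) (c : (codingYx P G (f j) (C37 j) (C38 j)).bg.Cfg) (B₀ δ : ℝ), F.MInv ≤ (geo9Y (f j)).M → 0 < α₀ → (geo9Y (f j)).M * α₀ ≤ F.aInv →
      (codingYx P G (f j) (C37 j) (C38 j)).bg.Reg335 c35 α₀ c → 0 < B₀ → 0 < δ → B9FromB6.L2Block (KSC₃Par P G (f j) (parA j) (parH j) (C37 j) (C38 j)) B₀ δ c →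
      ∀ k l : Fin (d + 1) ⊕ Fin (d + 1), B6RandomWalkL2.HasL2Majorant (g := B9Thm34Ext.toB6 (geo9Y (f j)) (F.Rr j) (F.Hp j))
        (fun p : SiteY (f j).toKIdx × ι => F.blk j p.1)
        (F.Gop j c * B9Eq352DivFormLetters.conj b (B9Eq352GradLetters.diffLetter (F.T j) (F.coord j c) ((((geo9Y (f j)).eta : ℂ))⁻¹) k) *
          B9Eq352DivFormLetters.conj b (B9Eq352GradLetters.diffLetter (F.T j) (F.coord j c) ((((geo9Y (f j)).eta : ℂ))⁻¹) l))
        (fun a a' => F.cL * B₀ * 1 * Real.exp (-(δ * (geo9Y (f j)).dist a a'))) := by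
    intro j α₀ c B₀ δ hM hα₀ hMa hreg hB₀ _ hL2 k l
    obtain ⟨U, rfl, hU⟩ := (codingYx P G (f j) (C37 j) (C38 j)).exists_of_bg_Reg335 hreg
    have hR : InRegY G (f j).toKIdx (parA j) U := ⟨hU.1.1, hparG j α₀ U hM hα₀ hMa hU⟩
    rw [hF]
    dsimp only [l2Frame₂CodedOnParSel, gpFrame₂CodedOnSel]
    erw [parSelC_base_of_inRegY G (f j).toKIdx (parA j) hR]
    exact readL2_five_KSC₃ P G (f j) (parA j) (C37 j) (C38 j) b (ιB j) (hι j) hM₂ hrepr hU.1.1 hB₀.le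
      ((l2Block_KSC₃Par_iff P G (f j) (parA j) (parH j) (C37 j) (C38 j) _).1 hL2) k l
  have w2 : ∀ j (c c' : (codingYx P G (f j) (C37 j) (C38 j)).bg.Cfg) (α₁ B δ : ℝ), 0 < α₁ → α₁ ≤ F.aW →
      (codingYx P G (f j) (C37 j) (C38 j)).bg.Cplx337 α₁ c c' → 0 ≤ B → 0 < δ →
      (∀ k : Fin (d + 1) ⊕ Fin (d + 1), B6RandomWalkL2.HasL2Majorant (g := B9Thm34Ext.toB6 (geo9Y (f j)) (F.Rr j) (F.Hp j))
          (fun p : SiteY (f j).toKIdx × ι => F.blk j p.1)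
          (F.Gop j ((codingYx P G (f j) (C37 j) (C38 j)).bg.mul c' c) *
            B9Eq352DivFormLetters.conj b (B9Eq352GradLetters.diffLetter (F.T j) (F.coord j c) ((((geo9Y (f j)).eta : ℂ))⁻¹) k))
          (fun a a' => B * (geo9Y (f j)).len a * Real.exp (-(δ * (geo9Y (f j)).dist a a')))) →
      ∀ (lam : (geo9Y (f j)).Loc) (h : (geo9Y (f j)).Cut) (y y' : (geo9Y (f j)).Site), (geo9Y (f j)).cutIn h y → (geo9Y (f j)).suppIn lam y' →
        (KSC₃Par P G (f j) (parA j) (parH j) (C37 j) (C38 j)).l2 2 ((codingYx P G (f j) (C37 j) (C38 j)).bg.mul c' c) lam h ≤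
          F.wL B δ * B9.pref6 ((geo9Y (f j)).len y) 2 * (geo9Y (f j)).cutSup h * Real.exp (-(F.wLδ δ * (geo9Y (f j)).dist y y')) *
            (geo9Y (f j)).l2Norm lam := by
    intro j c c' α₁ B δ _ _ h37 hB _ hG lam h y y' hc hs
    obtain ⟨U, a, rfl, rfl, hC⟩ := (codingYx P G (f j) (C37 j) (C38 j)).exists_of_bg_Cplx337 h37
    have hR : InRegY G (f j).toKIdx (parA j) U := ⟨(hC37 j _ U a hC).1, hparC j _ U a hC⟩
    rw [hF] at hG
    dsimp only [l2Frame₂CodedOnParSel, gpFrame₂CodedOnSel] at hG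
    erw [parSelC_base_of_inRegY G (f j).toKIdx (parA j) hR] at hG
    exact writeL2_two_KSC₃ P G (f j) (parA j) (C37 j) (C38 j) b (ιB j) (hι j) hM₂ hrepr (hC37 j _ U a hC).1 a hB hG lam h y y' hc hs
  have w3 : ∀ j (c c' : (codingYx P G (f j) (C37 j) (C38 j)).bg.Cfg) (α₁ B δ : ℝ), 0 < α₁ → α₁ ≤ F.aW →
      (codingYx P G (f j) (C37 j) (C38 j)).bg.Cplx337 α₁ c c' → 0 ≤ B → 0 < δ →
      (∀ k l : Fin (d + 1) ⊕ Fin (d + 1), B6RandomWalkL2.HasL2Majorant (g := B9Thm34Ext.toB6 (geo9Y (f j)) (F.Rr j) (F.Hp j))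
          (fun p : SiteY (f j).toKIdx × ι => F.blk j p.1)
          (B9Eq352DivFormLetters.conj b (B9Eq352GradLetters.diffLetter (F.T j) (F.coord j c) ((((geo9Y (f j)).eta : ℂ))⁻¹) k) *
            B9Eq352DivFormLetters.conj b (B9Eq352GradLetters.diffLetter (F.T j) (F.coord j c) ((((geo9Y (f j)).eta : ℂ))⁻¹) l) *
            F.Gop j ((codingYx P G (f j) (C37 j) (C38 j)).bg.mul c' c))
          (fun a a' => B * 1 * Real.exp (-(δ * (geo9Y (f j)).dist a a')))) →
      ∀ (lam : (geo9Y (f j)).Loc) (h : (geo9Y (f j)).Cut) (y y' : (geo9Y (f j)).Site), (geo9Y (f j)).cutIn h y → (geo9Y (f j)).suppIn lam y' →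
        (KSC₃Par P G (f j) (parA j) (parH j) (C37 j) (C38 j)).l2 3 ((codingYx P G (f j) (C37 j) (C38 j)).bg.mul c' c) lam h ≤
          F.wL B δ * B9.pref6 ((geo9Y (f j)).len y) 3 * (geo9Y (f j)).cutSup h * Real.exp (-(F.wLδ δ * (geo9Y (f j)).dist y y')) *
            (geo9Y (f j)).l2Norm lam := by
    intro j c c' α₁ B δ _ _ h37 hB _ hG lam h y y' hc hs
    obtain ⟨U, a, rfl, rfl, hC⟩ := (codingYx P G (f j) (C37 j) (C38 j)).exists_of_bg_Cplx337 h37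
    have hR : InRegY G (f j).toKIdx (parA j) U := ⟨(hC37 j _ U a hC).1, hparC j _ U a hC⟩
    rw [hF] at hG
    dsimp only [l2Frame₂CodedOnParSel, gpFrame₂CodedOnSel] at hG
    erw [parSelC_base_of_inRegY G (f j).toKIdx (parA j) hR] at hG
    exact writeL2_three_KSC₃ P G (f j) (parA j) (C37 j) (C38 j) b (ιB j) (hι j) hM₂ hrepr (hC37 j _ U a hC).1 a hB hG lam h y y' hc hs
  have w4 : ∀ j (c c' : (codingYx P G (f j) (C37 j) (C38 j)).bg.Cfg) (α₁ B δ : ℝ), 0 < α₁ → α₁ ≤ F.aW →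
      (codingYx P G (f j) (C37 j) (C38 j)).bg.Cplx337 α₁ c c' → 0 ≤ B → 0 < δ →
      (∀ k l : Fin (d + 1) ⊕ Fin (d + 1), B6RandomWalkL2.HasL2Majorant (g := B9Thm34Ext.toB6 (geo9Y (f j)) (F.Rr j) (F.Hp j))
          (fun p : SiteY (f j).toKIdx × ι => F.blk j p.1)
          (B9Eq352DivFormLetters.conj b (B9Eq352GradLetters.diffLetter (F.T j) (F.coord j c) ((((geo9Y (f j)).eta : ℂ))⁻¹) k) *
            F.Gop j ((codingYx P G (f j) (C37 j) (C38 j)).bg.mul c' c) *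
            B9Eq352DivFormLetters.conj b (B9Eq352GradLetters.diffLetter (F.T j) (F.coord j c) ((((geo9Y (f j)).eta : ℂ))⁻¹) l))
          (fun a a' => B * 1 * Real.exp (-(δ * (geo9Y (f j)).dist a a')))) →
      ∀ (lam : (geo9Y (f j)).Loc) (h : (geo9Y (f j)).Cut) (y y' : (geo9Y (f j)).Site), (geo9Y (f j)).cutIn h y → (geo9Y (f j)).suppIn lam y' →
        (KSC₃Par P G (f j) (parA j) (parH j) (C37 j) (C38 j)).l2 4 ((codingYx P G (f j) (C37 j) (C38 j)).bg.mul c' c) lam h ≤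
          F.wL B δ * B9.pref6 ((geo9Y (f j)).len y) 4 * (geo9Y (f j)).cutSup h * Real.exp (-(F.wLδ δ * (geo9Y (f j)).dist y y')) *
            (geo9Y (f j)).l2Norm lam := by
    intro j c c' α₁ B δ _ _ h37 hB _ hG lam h y y' hc hs
    obtain ⟨U, a, rfl, rfl, hC⟩ := (codingYx P G (f j) (C37 j) (C38 j)).exists_of_bg_Cplx337 h37
    have hR : InRegY G (f j).toKIdx (parA j) U := ⟨(hC37 j _ U a hC).1, hparC j _ U a hC⟩
    rw [hF] at hG
    dsimp only [l2Frame₂CodedOnParSel, gpFrame₂CodedOnSel] at hG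
    erw [parSelC_base_of_inRegY G (f j).toKIdx (parA j) hR] at hG
    exact writeL2_four_KSC₃ P G (f j) (parA j) (C37 j) (C38 j) b (ιB j) (hι j) hM₂ hrepr (hC37 j _ U a hC).1 a hB hG lam h y y' hc hs
  have w5 : ∀ j (c c' : (codingYx P G (f j) (C37 j) (C38 j)).bg.Cfg) (α₁ B δ : ℝ), 0 < α₁ → α₁ ≤ F.aW →
      (codingYx P G (f j) (C37 j) (C38 j)).bg.Cplx337 α₁ c c' → 0 ≤ B → 0 < δ →
      (∀ k l : Fin (d + 1) ⊕ Fin (d + 1), B6RandomWalkL2.HasL2Majorant (g := B9Thm34Ext.toB6 (geo9Y (f j)) (F.Rr j) (F.Hp j))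
          (fun p : SiteY (f j).toKIdx × ι => F.blk j p.1)
          (F.Gop j ((codingYx P G (f j) (C37 j) (C38 j)).bg.mul c' c) *
            B9Eq352DivFormLetters.conj b (B9Eq352GradLetters.diffLetter (F.T j) (F.coord j c) ((((geo9Y (f j)).eta : ℂ))⁻¹) k) *
            B9Eq352DivFormLetters.conj b (B9Eq352GradLetters.diffLetter (F.T j) (F.coord j c) ((((geo9Y (f j)).eta : ℂ))⁻¹) l))
          (fun a a' => B * 1 * Real.exp (-(δ * (geo9Y (f j)).dist a a')))) →
      ∀ (lam : (geo9Y (f j)).Loc) (h : (geo9Y (f j)).Cut) (y y' : (geo9Y (f j)).Site), (geo9Y (f j)).cutIn h y → (geo9Y (f j)).suppIn lam y' →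
        (KSC₃Par P G (f j) (parA j) (parH j) (C37 j) (C38 j)).l2 5 ((codingYx P G (f j) (C37 j) (C38 j)).bg.mul c' c) lam h ≤
          F.wL B δ * B9.pref6 ((geo9Y (f j)).len y) 5 * (geo9Y (f j)).cutSup h * Real.exp (-(F.wLδ δ * (geo9Y (f j)).dist y y')) *
            (geo9Y (f j)).l2Norm lam := by
    intro j c c' α₁ B δ _ _ h37 hB _ hG lam h y y' hc hs
    obtain ⟨U, a, rfl, rfl, hC⟩ := (codingYx P G (f j) (C37 j) (C38 j)).exists_of_bg_Cplx337 h37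
    have hR : InRegY G (f j).toKIdx (parA j) U := ⟨(hC37 j _ U a hC).1, hparC j _ U a hC⟩
    rw [hF] at hG
    dsimp only [l2Frame₂CodedOnParSel, gpFrame₂CodedOnSel] at hG
    erw [parSelC_base_of_inRegY G (f j).toKIdx (parA j) hR] at hG
    exact writeL2_five_KSC₃ P G (f j) (parA j) (C37 j) (C38 j) b (ιB j) (hι j) hM₂ hrepr (hC37 j _ U a hC).1 a hB hG lam h y y' hc hs
  match n with
  | 0 => exact B9SectBL2StepAtLettersV2.stepL2nPos_zero_of_l2Frame₂ F GA Cinv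
  | 1 => exact B9SectBL2StepAtLettersV2.stepL2nPos_one_of_l2Frame₂ F GA Cinv
  | 2 => exact B9SectBL2StepAtLettersV2Right.stepL2nPos_two_of_l2Frame₂ F r2 w2 GA Cinv
  | 3 => exact B9SectBL2StepAtLettersV2Second.stepL2nPos_three_of_l2Frame₂ F r3 w3 GA Cinv
  | 4 => exact B9SectBL2StepAtLettersV2Mixed.stepL2nPos_four_of_l2Frame₂ F r2 r4 w4 GA Cinv
  | 5 => exact B9SectBL2StepAtLettersV2Second.stepL2nPos_five_of_l2Frame₂ F r2 r5 w5 GA Cinv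

/-- ★★ **THE POSITIVE-INPUT (3.46) BLOCK-STEP `StepL2Pos` OF `KSC₃Par parA parH` ON A SUBFAMILY** (the six members assembled by `B9SectBStepWhole.stepL2Pos_of_members` at
the model signs of the record geometry). [cite: Balaban1985BackgroundPropagators, Thm 3.1 (3.46) p.398, Thm 3.4 p.400, p.403 l.1–9] -/
theorem stepL2Pos_KSC₃ParG_on (hι : ∀ (j : J) (s : BlkY (f j).toKIdx), β (f j).toKIdx.hN (f j).toKIdx.D (f j).toKIdx.hk (ιB j s) = s)
    (hG1 : ∀ u : 𝔸ˣ, u ∈ G → ‖(u : 𝔸)‖ ≤ 1)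
    (dB : ℕ) (M₂ : ℝ) (hM₂ : 0 ≤ M₂) (hrepr : ∀ (v : 𝔸) (j : ι), |b.repr v j| ≤ M₂ * ‖v‖) (hcR : 0 < M₂ * ∑ j, ‖b j‖)
    (hcL : 0 < Real.sqrt (Fintype.card ι) * M₂ * ∑ j, ‖b j‖)
    (Cq : ℝ) (hCq : 0 ≤ Cq) (hC37 : ∀ j β' U a, C37 j β' U a → GVal G (f j).toKIdx U ∧ CplxLettersY G (f j) (parA j) (ιB j) Cq β' U a)
    (MInv aInv aW : ℝ) (hMInv : 0 < MInv) (haInv : 0 < aInv) (haW : 0 < aW)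
    (hparG : ∀ j (α₀ : ℝ) (U : CfgY 𝔸 (f j).toKIdx), MInv ≤ (geo9Y (f j)).M → 0 < α₀ → (geo9Y (f j)).M * α₀ ≤ aInv →
      (bg9YC 𝔸 G P (f j)).Reg335 c35 α₀ U → ∀ z w, parA j U z w ∈ G)
    (hparC : ∀ j β' U a, C37 j β' U a → ∀ z w, parA j U z w ∈ G)
    (hunitG : ∀ j (α₀ : ℝ) (U : CfgY 𝔸 (f j).toKIdx), MInv ≤ (geo9Y (f j)).M → 0 < α₀ → (geo9Y (f j)).M * α₀ ≤ aInv →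
      (bg9YC 𝔸 G P (f j)).Reg335 c35 α₀ U → IsUnit (deltaPrimeAY (f j).toKIdx (parA j) U))
    (GA : ∀ j : J, B9.KernelFamily (geo9Y (f j)) (codingYx P G (f j) (C37 j) (C38 j)).bg)
    (Cinv : ∀ j : J, B9.SiteKernel (geo9Y (f j)) (codingYx P G (f j) (C37 j) (C38 j)).bg) :
    StepL2Pos dB c35 (fun j => geo9Y (f j)) (fun j => (codingYx P G (f j) (C37 j) (C38 j)).bg) (fun j => KSC₃Par P G (f j) (parA j) (parH j) (C37 j) (C38 j)) GA Cinv
      (fun j => KSC₃Par P G (f j) (parA j) (parH j) (C37 j) (C38 j)) :=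
  stepL2Pos_of_members (d := dB) (c35 := c35) (geo := fun j => geo9Y (f j)) (bg := fun j => (codingYx P G (f j) (C37 j) (C38 j)).bg)
    (Gp := fun j => KSC₃Par P G (f j) (parA j) (parH j) (C37 j) (C38 j)) (GA := GA) (Cinv := Cinv) (fun j => modelSignsOn_geo9K (f j).toKIdx)
    fun n => stepL2nPos_KSC₃ParG_on P f c35 G b C37 C38 parA parH ιB hι hG1 dB M₂ hM₂ hrepr hcR hcL Cq hCq hC37 MInv aInv aW hMInv haInv haW hparG hparC hunitG GA Cinv n

/-! ## §4 The (3.46) output transport and the member of the Sect.-B step of record -/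


/-- ★★★ **`StepL2Pos` OF THE TWO-TRANSPORTER READING OVER THE CODED CARRIER — THE (3.46) MEMBER OF THE SECT.-B STEP OF RECORD FOR `(KSCUPar parA parH, KACU, C⁻¹)`**
(all six (3.46) members; input families `(KSCUPar, KACU, pullS C⁻¹)`): `stepL2Pos_KSC₃ParG_on` (with `GA := KACU`, `Cinv := pullS C⁻¹`) transported by
`stepL2Pos_of_family_pos` — `hin_KSCUPar₃_on_pos`, `houtL2_KSCUPar_on`.  Binders = `B9SectBStepUGuardedR.stepL2Pos_KSCU_on_g`'s with `par ↦ parA` (root-frame laws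
`hparG hparC hunitG hC37` at `parA` (GUARDED), `hcL`, the GUARDED plaquette law `hplaq` asked only at `M ≥ MInv`, `0 < α₀`, `M·α₀ ≤ aInv`); NO law of the Hölder transporter `parH`.
[cite: Balaban1985BackgroundPropagators, Thm 3.1 (3.46) p.398, Thm 3.4 p.400, (3.63)–(3.67) pp.402–403, p.403 l.1–9, p.404 (after (3.69)); Balaban1984PropagatorsII, Prop. 2.6 (2.140)–(2.141) p.247, Lemma 2.1 p.234] -/
theorem stepL2Pos_KSCUParG_on (hι : ∀ (j : J) (s : BlkY (f j).toKIdx), β (f j).toKIdx.hN (f j).toKIdx.D (f j).toKIdx.hk (ιB j s) = s)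
    (hG1 : ∀ u : 𝔸ˣ, u ∈ G → ‖(u : 𝔸)‖ ≤ 1)
    (dB : ℕ) (M₂ : ℝ) (hM₂ : 0 ≤ M₂) (hrepr : ∀ (v : 𝔸) (j : ι), |b.repr v j| ≤ M₂ * ‖v‖) (hcR : 0 < M₂ * ∑ j, ‖b j‖)
    (hcL : 0 < Real.sqrt (Fintype.card ι) * M₂ * ∑ j, ‖b j‖)
    (Cq : ℝ) (hCq : 0 ≤ Cq) (hC37 : ∀ j β' U a, C37 j β' U a → GVal G (f j).toKIdx U ∧ CplxLettersY G (f j) (parA j) (ιB j) Cq β' U a)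
    (MInv aInv aW : ℝ) (hMInv : 0 < MInv) (haInv : 0 < aInv) (haW : 0 < aW)
    (hparG : ∀ j (α₀ : ℝ) (U : CfgY 𝔸 (f j).toKIdx), MInv ≤ (geo9Y (f j)).M → 0 < α₀ → (geo9Y (f j)).M * α₀ ≤ aInv →
      (bg9YC 𝔸 G P (f j)).Reg335 c35 α₀ U → ∀ z w, parA j U z w ∈ G)
    (hparC : ∀ j β' U a, C37 j β' U a → ∀ z w, parA j U z w ∈ G)
    (hunitG : ∀ j (α₀ : ℝ) (U : CfgY 𝔸 (f j).toKIdx), MInv ≤ (geo9Y (f j)).M → 0 < α₀ → (geo9Y (f j)).M * α₀ ≤ aInv →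
      (bg9YC 𝔸 G P (f j)).Reg335 c35 α₀ U → IsUnit (deltaPrimeAY (f j).toKIdx (parA j) U)) {cP : ℝ} (hcP : 0 ≤ cP)
    (hplaq : ∀ (j : J) (α₀ : ℝ) (U : CfgY 𝔸 (f j).toKIdx), MInv ≤ (geo9Y (f j)).M → 0 < α₀ → (geo9Y (f j)).M * α₀ ≤ aInv →
      (bg9YC 𝔸 G P (f j)).Reg335 c35 α₀ U → PlaqLawY (f j) (ιB j) cP U) :
    StepL2Pos dB c35 (fun j => geo9Y (f j)) (fun j => (codingYx P G (f j) (C37 j) (C38 j)).bg)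
      (fun j => KSCUPar P G (f j) (parA j) (parH j) (C37 j) (C38 j)) (fun j => KACU P G (f j) (OA j) (parB j) (C37 j) (C38 j))
      (fun j => pullS (codingYx P G (f j) (C37 j) (C38 j)) (Cinv j)) (fun j => KSCUPar P G (f j) (parA j) (parH j) (C37 j) (C38 j)) :=
  stepL2Pos_of_family_pos dB c35 (fun j => geo9Y (f j)) (fun j => (codingYx P G (f j) (C37 j) (C38 j)).bg)
    (fun j => KSC₃Par P G (f j) (parA j) (parH j) (C37 j) (C38 j)) (fun j => KSCUPar P G (f j) (parA j) (parH j) (C37 j) (C38 j))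
    (fun j => KACU P G (f j) (OA j) (parB j) (C37 j) (C38 j)) (fun j => KACU P G (f j) (OA j) (parB j) (C37 j) (C38 j))
    (fun j => KSC₃Par P G (f j) (parA j) (parH j) (C37 j) (C38 j)) (fun j => KSCUPar P G (f j) (parA j) (parH j) (C37 j) (C38 j))
    (fun j => pullS (codingYx P G (f j) (C37 j) (C38 j)) (Cinv j))
    (hin_KSCUPar₃_on_pos P f c35 G b C37 C38 parA parH OA parB ιB Cinv hι hG1 hM₂ hrepr dB hcP haInv hplaq)
    (houtL2_KSCUPar_on P f c35 G C37 C38 parA parH)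
    (stepL2Pos_KSC₃ParG_on P f c35 G b C37 C38 parA parH ιB hι hG1 dB M₂ hM₂ hrepr hcR hcL Cq hCq hC37 MInv aInv aW hMInv haInv haW hparG hparC hunitG _ _)

end L2

/-! ## §3 The (3.43) member -/

section H1

open Literature.MathematicalPhysics.QuantumFieldTheory.Balaban1983to89.B9SectBCodedClassR (RegExtraY bg9YC)
open Literature.MathematicalPhysics.QuantumFieldTheory.Balaban1983to89.B9SectBCodedFamiliesUParH
open B6RandomWalk (HasMajorant hasMajorant_mono BlockSupp)
open B6KLevelCensusIndexV1 (KIdx kGeo)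
open B6Ineq2142KLevelV1 (β beta_level)
open B6Prop22KLevelTorusCensusEta (nKT nKT_pos hqTP hqTP_nonneg lenT_le_one geoTP_len)
open B9Thm34Ext (toB6)
open B9FromB6 (EBlock H1Block)
open B9Eq352DivFormLetters (conj coordEquiv gradLetterF gradLetterB)
open B9Eq352GradLetters (diffLetter diffLetter_inl diffLetter_inr)
open B9Thm34SectBUniformR1 (thm34_Gp_uniform)
open B9Thm34HolderGpUniformR1 (thm34_Gp_holderLeft_uniform thm34_Gp_holderRight_uniform)
open B9SectBGpStepAtLettersV2 (GpFrame₂)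
open B9SectBStepWhole (StepPos StepH1Pos)
open B9SectBCodedCarrier (CCfg Coding pullK pullS)
open B9Eq360DeltaPrimeAY (AfldY blkY)
open B9PinMembersKLevelV1 (MemberY geo9Y bg9Y)
open B9SectBGpLettersY (GVal decY coordC blkC GopC letters_base_of_gVal norm_le_one_and_inv_of_mem stencil0_geo9K)
open B9SectBGpFrameCodedYR (codingYx Read342Y Write342Y)
open B9SectBGpFrameCodedY (CplxLettersY)
open B9SectBGpReadingsYR (KSC read342Y_KSC write342Y_KSC)
open B9SectBGpReadingsY (baseY etaS_eq_eta)
open B9SectBCodedReadingsUR (KSCU KACU)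
open B9SectBCodedReadingsUParH (KSCUPar)
open B9SectBStepsKSCUR (KACU_members_base ineq342_346_347_congr thms_KSCU_base_iff hin_KSCU_on_pos)
open B9SectBGpTransferInYR (ineq343_345_congr)
open B9SectBCodedChainOnSubfamilyR (gpFrame₂CodedOn)
open B9SectBStepPosFamilyTransfer (stepH1Pos_of_family_pos)
open B9RWSumsReadsNbr (nbr mem_nbr)
open B9GeoNbrCountKLevelV1 (exists_card_nbr_geo9Y_le_of_M)
open B9GeoLemma21KLevelV1 (geo9Y_dist_triangle geo9Y_len_pos)
open B9RWSums347DefiniteFacesWindow (geo9Y_dist_nonneg)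
open B9GeoNormsKLevelModelSignsV1 (modelSignsOn_geo9K)
open Node00 (SiteY BlkY IBondY CfgY BallY SiteParY BondParY BondOpY liftY deltaPrimeAY kernelFamilyS GpY UboxY shiftY etaS cdS cdsS cdS_smul toKT parSymY parSymY_mem)
open Node00.OpsYRead342 (geo9K_len_congr geo9K_dist_congr)
open B9Ineq349SiteComposite (cdSL cdsSL cdSL_apply cdsSL_apply etaS_pos supBlkS'_le)
open B9SectBH1ReadWriteY (wordS quotS h1ReadT quotS_nonneg h1ReadT_le_of_probes)
open B9SectBH1ProbesY (probeH probeH_apply norm_probeH quotS_wordS_eq Gsc symm_conj_G symm_gradF_G symm_G_negGradB symm_G_gradF cutH_inl_nonneg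
  cutH_inl_eq HolderLipY quot_undiff_le quotL_blockSupp_le quotR_blockSupp_le quotRF_cross_symm_le norm_symm_apply_le_of_hasMajorant
  blockSupp_coordEquiv_liftY)
open B9SectBH1FrameCodedY (H1Frame₃ stepH1Pos_of_h1Frame₃ wH5 wH5_nonneg probe_undiff_le probe_cross_le len_blkC_eq pow_level_mul_etaS_le_one)
open B9Eq340HolderLipParSymYR (hLip_parSymY)
open Literature.MathematicalPhysics.QuantumFieldTheory.Balaban1983to89.B9SectBParSelY
open Literature.MathematicalPhysics.QuantumFieldTheory.Balaban1983to89.B9SectBFramesSelY (gpFrame₂CodedOnSel anFrame₂CodedOnSel cinvFrame₃CodedOnSel e4Frame₃CodedOnSel)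
open Literature.MathematicalPhysics.QuantumFieldTheory.Balaban1983to89.B9SectBCodedFamiliesUParH
open Literature.MathematicalPhysics.QuantumFieldTheory.Balaban1983to89.B9SectBL2StepUParH (KSC₃Par KSC₃Par_members KSC₃Par_members₇ eBlock_KSC₃Par_iff l2Block_KSC₃Par_iff read342Y_KSC₃Par write342Y_KSC₃Par hin_KSCUPar₃_on_pos houtL2_KSCUPar_on)
open Literature.MathematicalPhysics.QuantumFieldTheory.Balaban1983to89.B9SectBH1StepUParH (h1_transfer_KSC₇Par)
open Literature.MathematicalPhysics.QuantumFieldTheory.Balaban1983to89.B9SectBH2StepUParH (h2_transfer_KSC₇Par)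

variable [NormOneClass 𝔸] [FiniteDimensional ℝ 𝔸] {J : Type} (f : J → MemberY d ℓ hd hL b₀ b₁ Mstar) [∀ x : MemberY d ℓ hd hL b₀ b₁ Mstar, Fintype (geo9Y x).Site]
  [instDS : ∀ x : MemberY d ℓ hd hL b₀ b₁ Mstar, DecidableEq (geo9Y x).Site] [instNE : ∀ x : MemberY d ℓ hd hL b₀ b₁ Mstar, Nonempty (geo9Y x).Site]
  (c35 : ℝ) (G : Subgroup 𝔸ˣ) (parA parH : ∀ j : J, SiteParY 𝔸 (f j).toKIdx) (OA : ∀ j : J, BondOpY 𝔸 (f j).toKIdx)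
  (parB : ∀ j : J, BondParY 𝔸 (f j).toKIdx) {ι : Type} [Fintype ι] [DecidableEq ι] (b : Module.Basis ι ℝ 𝔸)
  (ιB : ∀ j : J, BlkY (f j).toKIdx → IBondY (f j).toKIdx)
  (C37 C38 : ∀ j : J, ℝ → CfgY 𝔸 (f j).toKIdx → AfldY 𝔸 (f j).toKIdx → Prop)
  (Cinv : ∀ j : J, B9.SiteKernel (geo9Y (f j)) (bg9YC 𝔸 G P (f j)))

/-- ★★ **THE (3.43) FRAME OVER THE CODED CARRIERS OF A SUBFAMILY, INHABITED FOR `KSC₇Par parA parH`**: the root frame `gpFrame₂CodedOn` AT `parA` (dictionaries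
`read342Y_KSC₇Par ∕ write342Y_KSC₇Par`, reading constant `c_R = M₂Σ‖b_j‖`; laws `hparG hparC hunitG hC37` (GUARDED by (3.35)∕(3.37)) at `parA`), the writing function `wH5`, `wHδ δc = 9δc∕10`, and the
transfer field `h1_transfer_KSC₇Par` (laws `hparH`, `hLip` at `parH`).  Displayed beyond
the root frame's data: the transporter law `hLip` (`Reg335 ⇒ HolderLipY c_Lip (parH U) U`) and the neighbour count `hnbr` above the frame's threshold `MInv`.
[cite: Balaban1985BackgroundPropagators, Thm 3.4 p.400, (3.43) p.398, p.403 l.1–9, (3.60)–(3.65) pp.402–403; Balaban1984PropagatorsII, Lemma 2.1 p.234, (2.51)–(2.52) p.232] -/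
noncomputable def h1Frame₃CodedOnParSel (hι : ∀ (j : J) (s : BlkY (f j).toKIdx), β (f j).toKIdx.hN (f j).toKIdx.D (f j).toKIdx.hk (ιB j s) = s)
    (hG1 : ∀ u : 𝔸ˣ, u ∈ G → ‖(u : 𝔸)‖ ≤ 1)
    (hparH : ∀ j (U : CfgY 𝔸 (f j).toKIdx), GVal G (f j).toKIdx U → ∀ z w, parH j U z w ∈ G)
    (dB : ℕ) (M₂ : ℝ) (hM₂ : 0 ≤ M₂) (hrepr : ∀ (v : 𝔸) (j : ι), |b.repr v j| ≤ M₂ * ‖v‖) (hcR : 0 < M₂ * ∑ j, ‖b j‖)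
    (Cq : ℝ) (hCq : 0 ≤ Cq) (hC37 : ∀ j β' U a, C37 j β' U a → GVal G (f j).toKIdx U ∧ CplxLettersY G (f j) (parA j) (ιB j) Cq β' U a)
    (MInv aInv aW : ℝ) (hMInv : 0 < MInv) (haInv : 0 < aInv) (haW : 0 < aW)
    (hparG : ∀ j (α₀ : ℝ) (U : CfgY 𝔸 (f j).toKIdx), MInv ≤ (geo9Y (f j)).M → 0 < α₀ → (geo9Y (f j)).M * α₀ ≤ aInv →
      (bg9YC 𝔸 G P (f j)).Reg335 c35 α₀ U → ∀ z w, parA j U z w ∈ G)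
    (hparC : ∀ j β' U a, C37 j β' U a → ∀ z w, parA j U z w ∈ G)
    (hunitG : ∀ j (α₀ : ℝ) (U : CfgY 𝔸 (f j).toKIdx), MInv ≤ (geo9Y (f j)).M → 0 < α₀ → (geo9Y (f j)).M * α₀ ≤ aInv →
      (bg9YC 𝔸 G P (f j)).Reg335 c35 α₀ U → IsUnit (deltaPrimeAY (f j).toKIdx (parA j) U))
    {cLip : ℝ} (hcLip : 0 ≤ cLip)
    (hLip : ∀ (j : J) (α₀ : ℝ) (U : CfgY 𝔸 (f j).toKIdx), (bg9YC 𝔸 G P (f j)).Reg335 c35 α₀ U → HolderLipY (f j).toKIdx cLip (parH j U) U)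
    {mN : ℕ} (hnbr : ∀ j : J, MInv ≤ (geo9Y (f j)).M → ∀ y' : IBondY (f j).toKIdx, (nbr (geo9Y (f j)) (2 * ((d : ℝ) + 1)) y').card ≤ mN) :
    H1Frame₃ c35 (fun j => geo9Y (f j)) (fun j => (codingYx P G (f j) (C37 j) (C38 j)).bg) (fun j => KSC₇Par P G (f j) (parA j) (parH j) (C37 j) (C38 j)) b
      (Fin (d + 1)) (fun j => SiteY (f j).toKIdx) :=
  { gpFrame₂CodedOnSel P f c35 G b C37 C38 parA ιB (fun j => KSC₇Par P G (f j) (parA j) (parH j) (C37 j) (C38 j)) hι hG1 dB M₂ hM₂ hrepr Cq hCq hC37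
      (M₂ * ∑ j, ‖b j‖) hcR (fun B _ => (M₂ * ∑ j, ‖b j‖) * B + 1) (fun B _ hB _ => by positivity) (fun δ => δ) (fun δ hδ => hδ)
      MInv aInv aW hMInv haInv haW hparG hparC hunitG (fun j => read342Y_KSC₇Par P G (f j) (parA j) (parH j) b (ιB j) (C37 j) (C38 j) (hι j) M₂ hM₂ hrepr c35 MInv aInv)
      (fun j => write342Y_KSC₇Par P G (f j) (parA j) (parH j) b (ιB j) (C37 j) (C38 j) (hι j) M₂ hM₂ hrepr aW fun β' U a h => (hC37 j β' U a h).1) with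
    wH := fun B₀ BL BR δc Bβ => wH5 (2 * ((d : ℝ) + 1)) (∑ j, ‖b j‖) M₂ (M₂ * ∑ j, ‖b j‖) cLip mN B₀ BL BR δc Bβ
    wHδ := fun δc => 9 / 10 * δc
    wHδ_pos := fun δc hδc => by positivity
    h1_transfer := fun j α₀ c c' α₁ B₀ BL BR δ δc Bβ hM hα₀ hMa hreg hα₁ haW' h37 hB₀ hBL hBR hδ hδc hδcδ hE hH1 HL HR => by
      obtain ⟨U, a, rfl, rfl, hC⟩ := (codingYx P G (f j) (C37 j) (C38 j)).exists_of_bg_Cplx337 h37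
      have hR : InRegY G (f j).toKIdx (parA j) U := ⟨(hC37 j α₁ U a hC).1, hparC j α₁ U a hC⟩
      dsimp only [gpFrame₂CodedOnSel] at HL HR
      erw [parSelC_base_of_inRegY G (f j).toKIdx (parA j) hR] at HL HR
      exact h1_transfer_KSC₇Par P c35 G (f j) (parA j) (parH j) b (ιB j) (C37 j) (C38 j) (hι j) hG1 (hparH j) hM₂ hrepr hcLip (hLip j) (hnbr j) hcR
        (read342Y_KSC₇Par P G (f j) (parA j) (parH j) b (ιB j) (C37 j) (C38 j) (hι j) M₂ hM₂ hrepr c35 MInv aInv)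
        α₀ (.base U) (.mult a) α₁ B₀ BL BR δ δc Bβ hM hα₀ hMa hreg hα₁ haW' h37 hB₀ hBL hBR hδ hδc hδcδ hE hH1 HL HR }

/-- ★★ **`StepH1Pos` OF `KSC₇Par parA parH` OVER THE CODED CARRIERS** (any shared `GA`, `Cinv` over the coded background): `stepH1Pos_of_h1Frame₃` on `h1Frame₃CodedOnParSel`.
[cite: Balaban1985BackgroundPropagators, Thm 3.4 p.400, Thm 3.1 (3.43) p.398, (3.60)–(3.65) pp.402–403; Balaban1984PropagatorsII, Lemma 2.1 p.234] -/
theorem stepH1Pos_KSC₇ParG_on (hι : ∀ (j : J) (s : BlkY (f j).toKIdx), β (f j).toKIdx.hN (f j).toKIdx.D (f j).toKIdx.hk (ιB j s) = s)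
    (hG1 : ∀ u : 𝔸ˣ, u ∈ G → ‖(u : 𝔸)‖ ≤ 1)
    (hparH : ∀ j (U : CfgY 𝔸 (f j).toKIdx), GVal G (f j).toKIdx U → ∀ z w, parH j U z w ∈ G)
    (dB : ℕ) (M₂ : ℝ) (hM₂ : 0 ≤ M₂) (hrepr : ∀ (v : 𝔸) (j : ι), |b.repr v j| ≤ M₂ * ‖v‖) (hcR : 0 < M₂ * ∑ j, ‖b j‖)
    (Cq : ℝ) (hCq : 0 ≤ Cq) (hC37 : ∀ j β' U a, C37 j β' U a → GVal G (f j).toKIdx U ∧ CplxLettersY G (f j) (parA j) (ιB j) Cq β' U a)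
    (MInv aInv aW : ℝ) (hMInv : 0 < MInv) (haInv : 0 < aInv) (haW : 0 < aW)
    (hparG : ∀ j (α₀ : ℝ) (U : CfgY 𝔸 (f j).toKIdx), MInv ≤ (geo9Y (f j)).M → 0 < α₀ → (geo9Y (f j)).M * α₀ ≤ aInv →
      (bg9YC 𝔸 G P (f j)).Reg335 c35 α₀ U → ∀ z w, parA j U z w ∈ G)
    (hparC : ∀ j β' U a, C37 j β' U a → ∀ z w, parA j U z w ∈ G)
    (hunitG : ∀ j (α₀ : ℝ) (U : CfgY 𝔸 (f j).toKIdx), MInv ≤ (geo9Y (f j)).M → 0 < α₀ → (geo9Y (f j)).M * α₀ ≤ aInv →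
      (bg9YC 𝔸 G P (f j)).Reg335 c35 α₀ U → IsUnit (deltaPrimeAY (f j).toKIdx (parA j) U))
    {cLip : ℝ} (hcLip : 0 ≤ cLip)
    (hLip : ∀ (j : J) (α₀ : ℝ) (U : CfgY 𝔸 (f j).toKIdx), (bg9YC 𝔸 G P (f j)).Reg335 c35 α₀ U → HolderLipY (f j).toKIdx cLip (parH j U) U)
    {mN : ℕ} (hnbr : ∀ j : J, MInv ≤ (geo9Y (f j)).M → ∀ y' : IBondY (f j).toKIdx, (nbr (geo9Y (f j)) (2 * ((d : ℝ) + 1)) y').card ≤ mN)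
    (GA : ∀ j : J, B9.KernelFamily (geo9Y (f j)) (codingYx P G (f j) (C37 j) (C38 j)).bg)
    (CinvC : ∀ j : J, B9.SiteKernel (geo9Y (f j)) (codingYx P G (f j) (C37 j) (C38 j)).bg) :
    StepH1Pos dB c35 (fun j => geo9Y (f j)) (fun j => (codingYx P G (f j) (C37 j) (C38 j)).bg) (fun j => KSC₇Par P G (f j) (parA j) (parH j) (C37 j) (C38 j)) GA CinvC
      (fun j => KSC₇Par P G (f j) (parA j) (parH j) (C37 j) (C38 j)) :=
  stepH1Pos_of_h1Frame₃ (d := dB)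
    (h1Frame₃CodedOnParSel P f c35 G parA parH b ιB C37 C38 hι hG1 hparH dB M₂ hM₂ hrepr hcR Cq hCq hC37 MInv aInv aW hMInv haInv haW hparG hparC hunitG hcLip hLip hnbr) GA CinvC

/-- ★★★ **`StepH1Pos` OF THE TWO-TRANSPORTER READING OVER THE CODED CARRIER — THE (3.43) MEMBER OF THE SECT.-B STEP OF RECORD FOR `(KSCUPar parA parH, KACU, C⁻¹)`**
(input families `(KSCUPar, KACU, pullS Cinv)`, output `KSCUPar`'s (3.43) block at the product): `stepH1Pos_KSC₇ParG_on` (with `GA := KACU`, `Cinv := pullS Cinv`)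
transported by `stepH1Pos_of_family_pos` — `hin_KSCUPar_on_pos`, identity output (`KSC₇Par.h1 = KSCUPar.h1`).  The neighbour count is taken above its own threshold
(`exists_card_nbr_geo9Y_le_of_M`, folded into the frame's `MInv`).  DISPLAYED beyond `B9SectBCodedFamiliesUParH.stepEPos_KSCUParG_on`'s data (laws `hparG hparC hunitG hC37` (GUARDED by (3.35)∕(3.37))
at the AVERAGING transporter `parA`): `hparH` (the HÖLDER transporters take values in `G`) and the transporter law `hLip` (`Reg335 ⇒ HolderLipY c_Lip (parH U) U`).
[cite: Balaban1985BackgroundPropagators, Thm 3.4 p.400, Thm 3.1 (3.43) p.398, (3.40) p.397, (3.21) p.394, p.403 l.1–9, (3.60)–(3.65) pp.402–403, (3.35)–(3.37) p.396; Balaban1984PropagatorsII, Lemma 2.1 p.234, (2.51)–(2.52) p.232] -/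
theorem stepH1Pos_KSCUParG_on (hι : ∀ (j : J) (s : BlkY (f j).toKIdx), β (f j).toKIdx.hN (f j).toKIdx.D (f j).toKIdx.hk (ιB j s) = s)
    (hG1 : ∀ u : 𝔸ˣ, u ∈ G → ‖(u : 𝔸)‖ ≤ 1)
    (hparH : ∀ j (U : CfgY 𝔸 (f j).toKIdx), GVal G (f j).toKIdx U → ∀ z w, parH j U z w ∈ G)
    (dB : ℕ) (M₂ : ℝ) (hM₂ : 0 ≤ M₂) (hrepr : ∀ (v : 𝔸) (j : ι), |b.repr v j| ≤ M₂ * ‖v‖) (hcR : 0 < M₂ * ∑ j, ‖b j‖)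
    (Cq : ℝ) (hCq : 0 ≤ Cq) (hC37 : ∀ j β' U a, C37 j β' U a → GVal G (f j).toKIdx U ∧ CplxLettersY G (f j) (parA j) (ιB j) Cq β' U a)
    (MInv aInv aW : ℝ) (hMInv : 0 < MInv) (haInv : 0 < aInv) (haW : 0 < aW)
    (hparG : ∀ j (α₀ : ℝ) (U : CfgY 𝔸 (f j).toKIdx), MInv ≤ (geo9Y (f j)).M → 0 < α₀ → (geo9Y (f j)).M * α₀ ≤ aInv →
      (bg9YC 𝔸 G P (f j)).Reg335 c35 α₀ U → ∀ z w, parA j U z w ∈ G)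
    (hparC : ∀ j β' U a, C37 j β' U a → ∀ z w, parA j U z w ∈ G)
    (hunitG : ∀ j (α₀ : ℝ) (U : CfgY 𝔸 (f j).toKIdx), MInv ≤ (geo9Y (f j)).M → 0 < α₀ → (geo9Y (f j)).M * α₀ ≤ aInv →
      (bg9YC 𝔸 G P (f j)).Reg335 c35 α₀ U → IsUnit (deltaPrimeAY (f j).toKIdx (parA j) U))
    {cLip : ℝ} (hcLip : 0 ≤ cLip)
    (hLip : ∀ (j : J) (α₀ : ℝ) (U : CfgY 𝔸 (f j).toKIdx), (bg9YC 𝔸 G P (f j)).Reg335 c35 α₀ U → HolderLipY (f j).toKIdx cLip (parH j U) U) :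
    StepH1Pos dB c35 (fun j => geo9Y (f j)) (fun j => (codingYx P G (f j) (C37 j) (C38 j)).bg)
      (fun j => KSCUPar P G (f j) (parA j) (parH j) (C37 j) (C38 j)) (fun j => KACU P G (f j) (OA j) (parB j) (C37 j) (C38 j))
      (fun j => pullS (codingYx P G (f j) (C37 j) (C38 j)) (Cinv j)) (fun j => KSCUPar P G (f j) (parA j) (parH j) (C37 j) (C38 j)) := by
  obtain ⟨ML, mN, hcnt⟩ := exists_card_nbr_geo9Y_le_of_M (d := d) (ℓ := ℓ) (hd := hd) (hL := hL) (b₀ := b₀) (b₁ := b₁) (2 * ((d : ℝ) + 1))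
  have hMInv' : 0 < max MInv ML := lt_max_of_lt_left hMInv
  have hnbr : ∀ j : J, max MInv ML ≤ (geo9Y (f j)).M → ∀ y' : IBondY (f j).toKIdx, (nbr (geo9Y (f j)) (2 * ((d : ℝ) + 1)) y').card ≤ mN :=
    fun j hM y' => hcnt Mstar (f j) (le_trans (le_max_right _ _) hM) y'
  have hparG' : ∀ j (α₀ : ℝ) (U : CfgY 𝔸 (f j).toKIdx), max MInv ML ≤ (geo9Y (f j)).M → 0 < α₀ → (geo9Y (f j)).M * α₀ ≤ aInv →
      (bg9YC 𝔸 G P (f j)).Reg335 c35 α₀ U → ∀ z w, parA j U z w ∈ G :=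
    fun j α₀ U hM hα₀ hMa hU => hparG j α₀ U (le_trans (le_max_left _ _) hM) hα₀ hMa hU
  have hunitG' : ∀ j (α₀ : ℝ) (U : CfgY 𝔸 (f j).toKIdx), max MInv ML ≤ (geo9Y (f j)).M → 0 < α₀ → (geo9Y (f j)).M * α₀ ≤ aInv →
      (bg9YC 𝔸 G P (f j)).Reg335 c35 α₀ U → IsUnit (deltaPrimeAY (f j).toKIdx (parA j) U) :=
    fun j α₀ U hM hα₀ hMa hU => hunitG j α₀ U (le_trans (le_max_left _ _) hM) hα₀ hMa hU
  refine stepH1Pos_of_family_pos dB c35 (fun j => geo9Y (f j)) (fun j => (codingYx P G (f j) (C37 j) (C38 j)).bg)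
    (fun j => KSC₇Par P G (f j) (parA j) (parH j) (C37 j) (C38 j)) (fun j => KSCUPar P G (f j) (parA j) (parH j) (C37 j) (C38 j))
    (fun j => KACU P G (f j) (OA j) (parB j) (C37 j) (C38 j)) (fun j => KACU P G (f j) (OA j) (parB j) (C37 j) (C38 j))
    (fun j => pullS (codingYx P G (f j) (C37 j) (C38 j)) (Cinv j))
    (fun j => KSC₇Par P G (f j) (parA j) (parH j) (C37 j) (C38 j)) (fun j => KSCUPar P G (f j) (parA j) (parH j) (C37 j) (C38 j))
    (hin_KSCUPar_on_pos P f c35 G parA parH OA parB b ιB C37 C38 Cinv hι hG1 hM₂ hrepr dB)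
    (fun Bβ δ a hδ ha => ⟨0, 1, a, Bβ, δ, one_pos, ha, le_rfl, hδ,
      fun j _ _ _ _ _ _ _ _ _ _ _ h => (h1Block_KSC₇Par_iff P G (f j) (parA j) (parH j) (C37 j) (C38 j) _).1 h⟩)
    (stepH1Pos_KSC₇ParG_on P f c35 G parA parH b ιB C37 C38 hι hG1 hparH dB M₂ hM₂ hrepr hcR Cq hCq hC37 (max MInv ML) aInv aW hMInv' haInv
      haW hparG' hparC hunitG' hcLip hLip hnbr _ _)

/-! ## §3 The Hölder transporter of record: `parH := parSymY` (print's shortest contours), laws discharged -/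

/-- ★★ **`StepH1Pos` OF `(KSCUPar parA parSymY, KACU, C⁻¹)` — THE HÖLDER TRANSPORTER OF RECORD, ITS TWO LAWS DISCHARGED**: `stepH1Pos_KSCUParG_on` at
`parH j := parSymY (f j).toKIdx` with `hparH := Node00.parSymY_mem` and `hLip := hLip_parSymY` (`c_Lip = d+1`); the AVERAGING transporter `parA` is a parameter with
its laws `hparG hparC hunitG hC37` (GUARDED by (3.35)∕(3.37)) displayed (at the knit instance `parA := parKnitY` they are dag-n06-l's K2 lemmas).  Binders = those of
`B9SectBCodedFamiliesUParH.stepEPos_KSCUParG_on`. [cite: Balaban1985BackgroundPropagators, Thm 3.4 p.400, Thm 3.1 (3.43) p.398, (3.40) p.397 («a shortest contour»), (3.21) p.394, p.403 l.1–9, (3.35)–(3.37) p.396; Balaban1984PropagatorsII, Lemma 2.1 p.234, (2.51)–(2.52) p.232] -/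
theorem stepH1Pos_KSCUParG_parSymYH_on (hι : ∀ (j : J) (s : BlkY (f j).toKIdx), β (f j).toKIdx.hN (f j).toKIdx.D (f j).toKIdx.hk (ιB j s) = s)
    (hG1 : ∀ u : 𝔸ˣ, u ∈ G → ‖(u : 𝔸)‖ ≤ 1)
    (dB : ℕ) (M₂ : ℝ) (hM₂ : 0 ≤ M₂) (hrepr : ∀ (v : 𝔸) (j : ι), |b.repr v j| ≤ M₂ * ‖v‖) (hcR : 0 < M₂ * ∑ j, ‖b j‖)
    (Cq : ℝ) (hCq : 0 ≤ Cq) (hC37 : ∀ j β' U a, C37 j β' U a → GVal G (f j).toKIdx U ∧ CplxLettersY G (f j) (parA j) (ιB j) Cq β' U a)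
    (MInv aInv aW : ℝ) (hMInv : 0 < MInv) (haInv : 0 < aInv) (haW : 0 < aW)
    (hparG : ∀ j (α₀ : ℝ) (U : CfgY 𝔸 (f j).toKIdx), MInv ≤ (geo9Y (f j)).M → 0 < α₀ → (geo9Y (f j)).M * α₀ ≤ aInv →
      (bg9YC 𝔸 G P (f j)).Reg335 c35 α₀ U → ∀ z w, parA j U z w ∈ G)
    (hparC : ∀ j β' U a, C37 j β' U a → ∀ z w, parA j U z w ∈ G)
    (hunitG : ∀ j (α₀ : ℝ) (U : CfgY 𝔸 (f j).toKIdx), MInv ≤ (geo9Y (f j)).M → 0 < α₀ → (geo9Y (f j)).M * α₀ ≤ aInv →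
      (bg9YC 𝔸 G P (f j)).Reg335 c35 α₀ U → IsUnit (deltaPrimeAY (f j).toKIdx (parA j) U)) :
    StepH1Pos dB c35 (fun j => geo9Y (f j)) (fun j => (codingYx P G (f j) (C37 j) (C38 j)).bg)
      (fun j => KSCUPar P G (f j) (parA j) (parSymY (f j).toKIdx) (C37 j) (C38 j)) (fun j => KACU P G (f j) (OA j) (parB j) (C37 j) (C38 j))
      (fun j => pullS (codingYx P G (f j) (C37 j) (C38 j)) (Cinv j))
      (fun j => KSCUPar P G (f j) (parA j) (parSymY (f j).toKIdx) (C37 j) (C38 j)) :=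
  stepH1Pos_KSCUParG_on P f c35 G parA (fun j => parSymY (f j).toKIdx) OA parB b ιB C37 C38 Cinv hι hG1 (fun j _ hU z w => parSymY_mem (f j).toKIdx hU z w) dB M₂
    hM₂ hrepr hcR Cq hCq hC37 MInv aInv aW hMInv haInv haW hparG hparC hunitG (by positivity : (0 : ℝ) ≤ (d : ℝ) + 1) (hLip_parSymY P f c35 G hG1)

end H1

/-! ## §4 The (3.45) member -/

section H2

open Literature.MathematicalPhysics.QuantumFieldTheory.Balaban1983to89.B9SectBCodedClassR (RegExtraY bg9YC)
open Literature.MathematicalPhysics.QuantumFieldTheory.Balaban1983to89.B9SectBCodedFamiliesUParH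
open Literature.MathematicalPhysics.QuantumFieldTheory.Balaban1983to89.B9SectBH2FrameCodedY
open B6RandomWalk (HasMajorant hasMajorant_mono BlockSupp)
open B6KLevelCensusIndexV1 (KIdx kGeo)
open B6Ineq2142KLevelV1 (β)
open B6Prop22KLevelTorusCensusEta (nKT nKT_pos hqTP hqTP_nonneg)
open B9Thm34Ext (toB6)
open B9FromB6 (EBlock H1Block E4Block H2Block)
open B9Eq352DivFormLetters (conj coordEquiv gradLetterF gradLetterB gradLetterF_apply)
open B9Eq352GradLetters (diffLetter diffLetter_inl diffLetter_inr)
open B9Thm34SectBUniformR1 (thm34_Gp_uniform)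
open B9Thm34HolderGpUniformR1 (thm34_Gp_holderInput_uniform)
open B9SectBGpStepAtLettersV2 (GpFrame₂)
open B9SectBStepWhole (StepPos StepH2Pos)
open B9SectBCodedCarrier (CCfg Coding pullK pullS)
open B9Eq360DeltaPrimeAY (AfldY blkY)
open B9PinMembersKLevelV1 (MemberY geo9Y bg9Y)
open B9SectBGpLettersY (GVal decY coordC blkC GopC letters_base_of_gVal norm_le_one_and_inv_of_mem stencilB_blkC)
open B9SectBGpFrameCodedYR (codingYx Read342Y Write342Y)
open B9SectBGpFrameCodedY (CplxLettersY)
open B9SectBGpReadingsYR (KSC read342Y_KSC write342Y_KSC)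
open B9SectBGpReadingsY (baseY etaS_eq_eta)
open B9SectBCodedReadingsUR (KSCU KACU)
open B9SectBStepsKSCUR (KACU_members_base ineq342_346_347_congr thms_KSCU_base_iff hin_KSCU_on_pos)
open B9SectBGpTransferInYR (ineq343_345_congr)
open B9SectBCodedChainOnSubfamilyR (gpFrame₂CodedOn)
open B9SectBStepPosFamilyTransfer (stepH2Pos_of_family_pos)
open B9GeoLemma21KLevelV1 (geo9Y_dist_triangle geo9Y_len_pos geo9Y_dist_comm)
open B9RWSums347DefiniteFacesWindow (geo9Y_dist_nonneg)
open B9GeoNormsKLevelModelSignsV1 (modelSignsOn_geo9K)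
open Node00 (SiteY BlkY IBondY CfgY BallY SiteParY BondParY BondOpY liftY deltaPrimeAY kernelFamilyS GpY UboxY shiftY etaS cdS cdsS cdS_smul hqS
  supBlkS' toKT)
open Node00.OpsYHolderFar (denS denS_nonneg pair_le_hqS hqS_le_of_forall hqS_nonneg)
open Node00.OpsYRead342 (geo9K_len_congr geo9K_dist_congr)
open Node00.OpsYRead342Cross (norm_cdsS_le_norm_cdS_symm_shift)
open B9Ineq349SiteComposite (cdSL cdsSL cdSL_apply cdsSL_apply etaS_pos)
open B9Ineq344LocalPairHolds (hqTP_mono_add)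
open B9SectBH1ReadWriteY (wordS quotS h1ReadT quotS_nonneg quotS_liftY_le)
open B9SectBH1ProbesY (probeH probeH_apply norm_probeH quotS_wordS_eq Gsc symm_conj_apply symm_gradF_G symm_G_negGradB cutH_inl_nonneg
  quotL_blockSupp_le norm_coordEquiv_symm_apply_le blockSupp_coordEquiv_liftY)
open B9SectBH1FrameCodedYR (KSC₅ KSC₅_h1_inl)
open B9SectBH1FrameCodedY (len_blkC_eq pow_level_mul_etaS_le_one)
open B9SectBE4FrameCodedYR (KSC₆ e4_read)
open B9SectBE4FrameCodedY (abs_apply_le_norm_symm norm_symm_gradF_G_negGradB norm_symm_negGradB_G_negGradB)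
open B9SectBCodedReadingsUParH (KSCUPar)
open B9GeoNbrCountKLevelV1 (exists_card_nbr_geo9Y_le_of_M)
open Literature.MathematicalPhysics.QuantumFieldTheory.Balaban1983to89.B9SectBParSelY
open Literature.MathematicalPhysics.QuantumFieldTheory.Balaban1983to89.B9SectBFramesSelY (gpFrame₂CodedOnSel anFrame₂CodedOnSel cinvFrame₃CodedOnSel e4Frame₃CodedOnSel)
open Literature.MathematicalPhysics.QuantumFieldTheory.Balaban1983to89.B9SectBCodedFamiliesUParH
open Literature.MathematicalPhysics.QuantumFieldTheory.Balaban1983to89.B9SectBL2StepUParH (KSC₃Par KSC₃Par_members KSC₃Par_members₇ eBlock_KSC₃Par_iff l2Block_KSC₃Par_iff read342Y_KSC₃Par write342Y_KSC₃Par hin_KSCUPar₃_on_pos houtL2_KSCUPar_on)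
open Literature.MathematicalPhysics.QuantumFieldTheory.Balaban1983to89.B9SectBH1StepUParH (h1_transfer_KSC₇Par)
open Literature.MathematicalPhysics.QuantumFieldTheory.Balaban1983to89.B9SectBH2StepUParH (h2_transfer_KSC₇Par)

variable [NormOneClass 𝔸] [FiniteDimensional ℝ 𝔸] {J : Type} (f : J → MemberY d ℓ hd hL b₀ b₁ Mstar) [∀ x : MemberY d ℓ hd hL b₀ b₁ Mstar, Fintype (geo9Y x).Site]
  [instDS : ∀ x : MemberY d ℓ hd hL b₀ b₁ Mstar, DecidableEq (geo9Y x).Site] [instNE : ∀ x : MemberY d ℓ hd hL b₀ b₁ Mstar, Nonempty (geo9Y x).Site]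
  (c35 : ℝ) (G : Subgroup 𝔸ˣ) (parA parH : ∀ j : J, SiteParY 𝔸 (f j).toKIdx) (OA : ∀ j : J, BondOpY 𝔸 (f j).toKIdx)
  (parB : ∀ j : J, BondParY 𝔸 (f j).toKIdx) {ι : Type} [Fintype ι] [DecidableEq ι] (b : Module.Basis ι ℝ 𝔸)
  (ιB : ∀ j : J, BlkY (f j).toKIdx → IBondY (f j).toKIdx)
  (C37 C38 : ∀ j : J, ℝ → CfgY 𝔸 (f j).toKIdx → AfldY 𝔸 (f j).toKIdx → Prop)
  (Cinv : ∀ j : J, B9.SiteKernel (geo9Y (f j)) (bg9YC 𝔸 G P (f j)))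

/-- ★★ **THE (3.45) FRAME OVER THE CODED CARRIERS OF A SUBFAMILY, INHABITED FOR `KSC₇Par parA parH`** (root frame at `parA`; laws `hparG hparC hunitG hC37` (GUARDED by (3.35)∕(3.37)) at `parA`; no `parH` law) (root frame `gpFrame₂CodedOn` with `KSC₇`'s dictionaries, writing function
`wH2₇`, rate `4δc∕5`, transfer field `h2_transfer_KSC₇`); no hypothesis beyond the root frame's.
[cite: Balaban1985BackgroundPropagators, Thm 3.4 p.400, (3.45) p.398, p.403 l.2–5, (3.60)–(3.65) pp.402–403; Balaban1984PropagatorsII, Lemma 2.1 p.234, (2.51)–(2.52) p.232] -/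
noncomputable def h2Frame₃CodedOnParSel (hι : ∀ (j : J) (s : BlkY (f j).toKIdx), β (f j).toKIdx.hN (f j).toKIdx.D (f j).toKIdx.hk (ιB j s) = s)
    (hG1 : ∀ u : 𝔸ˣ, u ∈ G → ‖(u : 𝔸)‖ ≤ 1)
    (dB : ℕ) (M₂ : ℝ) (hM₂ : 0 ≤ M₂) (hrepr : ∀ (v : 𝔸) (j : ι), |b.repr v j| ≤ M₂ * ‖v‖) (hcR : 0 < M₂ * ∑ j, ‖b j‖)
    (Cq : ℝ) (hCq : 0 ≤ Cq) (hC37 : ∀ j β' U a, C37 j β' U a → GVal G (f j).toKIdx U ∧ CplxLettersY G (f j) (parA j) (ιB j) Cq β' U a)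
    (MInv aInv aW : ℝ) (hMInv : 0 < MInv) (haInv : 0 < aInv) (haW : 0 < aW)
    (hparG : ∀ j (α₀ : ℝ) (U : CfgY 𝔸 (f j).toKIdx), MInv ≤ (geo9Y (f j)).M → 0 < α₀ → (geo9Y (f j)).M * α₀ ≤ aInv →
      (bg9YC 𝔸 G P (f j)).Reg335 c35 α₀ U → ∀ z w, parA j U z w ∈ G)
    (hparC : ∀ j β' U a, C37 j β' U a → ∀ z w, parA j U z w ∈ G)
    (hunitG : ∀ j (α₀ : ℝ) (U : CfgY 𝔸 (f j).toKIdx), MInv ≤ (geo9Y (f j)).M → 0 < α₀ → (geo9Y (f j)).M * α₀ ≤ aInv →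
      (bg9YC 𝔸 G P (f j)).Reg335 c35 α₀ U → IsUnit (deltaPrimeAY (f j).toKIdx (parA j) U)) :
    H2Frame₃ c35 (fun j => geo9Y (f j)) (fun j => (codingYx P G (f j) (C37 j) (C38 j)).bg) (fun j => KSC₇Par P G (f j) (parA j) (parH j) (C37 j) (C38 j)) b
      (Fin (d + 1)) (fun j => SiteY (f j).toKIdx) :=
  { gpFrame₂CodedOnSel P f c35 G b C37 C38 parA ιB (fun j => KSC₇Par P G (f j) (parA j) (parH j) (C37 j) (C38 j)) hι hG1 dB M₂ hM₂ hrepr Cq hCq hC37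
      (M₂ * ∑ j, ‖b j‖) hcR (fun B _ => (M₂ * ∑ j, ‖b j‖) * B + 1) (fun B _ hB _ => by positivity) (fun δ => δ) (fun δ hδ => hδ)
      MInv aInv aW hMInv haInv haW hparG hparC hunitG (fun j => read342Y_KSC₇Par P G (f j) (parA j) (parH j) b (ιB j) (C37 j) (C38 j) (hι j) M₂ hM₂ hrepr c35 MInv aInv)
      (fun j => write342Y_KSC₇Par P G (f j) (parA j) (parH j) b (ιB j) (C37 j) (C38 j) (hι j) M₂ hM₂ hrepr aW fun β' U a h => (hC37 j β' U a h).1) with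
    wH2 := fun B δc Bβ Bε Bεβ => wH2₇ (2 * ((d : ℝ) + 1)) (∑ j, ‖b j‖) M₂ B δc Bβ Bε Bεβ
    wH2δ := fun δc => 4 / 5 * δc
    wH2δ_pos := fun δc hδc => by positivity
    h2_transfer := fun j α₀ c c' α₁ B₀ B δ δc Bβ Bε Bεβ hM hα₀ hMa hreg hα₁ haW' h37 hB₀ hB hδ hδc hδcδ hE hHol HVI => by
      obtain ⟨U, a, rfl, rfl, hC⟩ := (codingYx P G (f j) (C37 j) (C38 j)).exists_of_bg_Cplx337 h37
      have hR : InRegY G (f j).toKIdx (parA j) U := ⟨(hC37 j α₁ U a hC).1, hparC j α₁ U a hC⟩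
      dsimp only [gpFrame₂CodedOnSel] at HVI
      erw [parSelC_base_of_inRegY G (f j).toKIdx (parA j) hR] at HVI
      exact h2_transfer_KSC₇Par P c35 G (f j) (parA j) (parH j) b (ιB j) (C37 j) (C38 j) (hι j) hG1 hM₂ hrepr hcR
        (read342Y_KSC₇Par P G (f j) (parA j) (parH j) b (ιB j) (C37 j) (C38 j) (hι j) M₂ hM₂ hrepr c35 MInv aInv)
        α₀ (.base U) (.mult a) α₁ B₀ B δ δc Bβ Bε Bεβ hM hα₀ hMa hreg hα₁ haW' h37 hB₀ hB hδ hδc hδcδ hE hHol HVI }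

/-- ★★ **`StepH2Pos` OF `KSC₇Par parA parH` OVER THE CODED CARRIERS** (any shared `GA`, `Cinv`). [cite: Balaban1985BackgroundPropagators, Thm 3.4 p.400, (3.45) p.398, p.403 l.2–5; Balaban1984PropagatorsII, Lemma 2.1 p.234] -/
theorem stepH2Pos_KSC₇ParG_on (hι : ∀ (j : J) (s : BlkY (f j).toKIdx), β (f j).toKIdx.hN (f j).toKIdx.D (f j).toKIdx.hk (ιB j s) = s)
    (hG1 : ∀ u : 𝔸ˣ, u ∈ G → ‖(u : 𝔸)‖ ≤ 1)
    (dB : ℕ) (M₂ : ℝ) (hM₂ : 0 ≤ M₂) (hrepr : ∀ (v : 𝔸) (j : ι), |b.repr v j| ≤ M₂ * ‖v‖) (hcR : 0 < M₂ * ∑ j, ‖b j‖)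
    (Cq : ℝ) (hCq : 0 ≤ Cq) (hC37 : ∀ j β' U a, C37 j β' U a → GVal G (f j).toKIdx U ∧ CplxLettersY G (f j) (parA j) (ιB j) Cq β' U a)
    (MInv aInv aW : ℝ) (hMInv : 0 < MInv) (haInv : 0 < aInv) (haW : 0 < aW)
    (hparG : ∀ j (α₀ : ℝ) (U : CfgY 𝔸 (f j).toKIdx), MInv ≤ (geo9Y (f j)).M → 0 < α₀ → (geo9Y (f j)).M * α₀ ≤ aInv →
      (bg9YC 𝔸 G P (f j)).Reg335 c35 α₀ U → ∀ z w, parA j U z w ∈ G)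
    (hparC : ∀ j β' U a, C37 j β' U a → ∀ z w, parA j U z w ∈ G)
    (hunitG : ∀ j (α₀ : ℝ) (U : CfgY 𝔸 (f j).toKIdx), MInv ≤ (geo9Y (f j)).M → 0 < α₀ → (geo9Y (f j)).M * α₀ ≤ aInv →
      (bg9YC 𝔸 G P (f j)).Reg335 c35 α₀ U → IsUnit (deltaPrimeAY (f j).toKIdx (parA j) U))
    (GA : ∀ j : J, B9.KernelFamily (geo9Y (f j)) (codingYx P G (f j) (C37 j) (C38 j)).bg)
    (CinvC : ∀ j : J, B9.SiteKernel (geo9Y (f j)) (codingYx P G (f j) (C37 j) (C38 j)).bg) :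
    StepH2Pos dB c35 (fun j => geo9Y (f j)) (fun j => (codingYx P G (f j) (C37 j) (C38 j)).bg) (fun j => KSC₇Par P G (f j) (parA j) (parH j) (C37 j) (C38 j)) GA CinvC
      (fun j => KSC₇Par P G (f j) (parA j) (parH j) (C37 j) (C38 j)) :=
  stepH2Pos_of_h2Frame₃ (d := dB)
    (h2Frame₃CodedOnParSel P f c35 G parA parH b ιB C37 C38 hι hG1 dB M₂ hM₂ hrepr hcR Cq hCq hC37 MInv aInv aW hMInv haInv haW hparG hparC hunitG) GA CinvC

/-- ★★★ **`StepH2Pos` OF THE TWO-TRANSPORTER READING OVER THE CODED CARRIER — THE (3.45) MEMBER OF THE SECT.-B STEP OF RECORD FOR `(KSCUPar parA parH, KACU, C⁻¹)`**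
(input families `(KSCUPar, KACU, pullS Cinv)`, output `KSCUPar`'s (3.45) block at the product): `stepH2Pos_KSC₇ParG_on` (with `GA := KACU`, `Cinv := pullS Cinv`)
transported by `stepH2Pos_of_family_pos` — `hin_KSCUPar_on_pos`, identity output (`KSC₇Par.h2 = KSCUPar.h2`).  Binders = those of
`B9SectBCodedFamiliesUParH.stepEPos_KSCUParG_on` (laws `hparG hparC hunitG hC37` (GUARDED by (3.35)∕(3.37)) at the AVERAGING transporter `parA`); no law of `parH`.
[cite: Balaban1985BackgroundPropagators, Thm 3.4 p.400, (3.45) p.398, (3.40) p.397, (3.21) p.394, p.403 l.2–5, (3.60)–(3.65) pp.402–403, (3.35)–(3.37) p.396; Balaban1984PropagatorsII, Lemma 2.1 p.234, (2.51)–(2.52) p.232] -/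
theorem stepH2Pos_KSCUParG_on (hι : ∀ (j : J) (s : BlkY (f j).toKIdx), β (f j).toKIdx.hN (f j).toKIdx.D (f j).toKIdx.hk (ιB j s) = s)
    (hG1 : ∀ u : 𝔸ˣ, u ∈ G → ‖(u : 𝔸)‖ ≤ 1)
    (dB : ℕ) (M₂ : ℝ) (hM₂ : 0 ≤ M₂) (hrepr : ∀ (v : 𝔸) (j : ι), |b.repr v j| ≤ M₂ * ‖v‖) (hcR : 0 < M₂ * ∑ j, ‖b j‖)
    (Cq : ℝ) (hCq : 0 ≤ Cq) (hC37 : ∀ j β' U a, C37 j β' U a → GVal G (f j).toKIdx U ∧ CplxLettersY G (f j) (parA j) (ιB j) Cq β' U a)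
    (MInv aInv aW : ℝ) (hMInv : 0 < MInv) (haInv : 0 < aInv) (haW : 0 < aW)
    (hparG : ∀ j (α₀ : ℝ) (U : CfgY 𝔸 (f j).toKIdx), MInv ≤ (geo9Y (f j)).M → 0 < α₀ → (geo9Y (f j)).M * α₀ ≤ aInv →
      (bg9YC 𝔸 G P (f j)).Reg335 c35 α₀ U → ∀ z w, parA j U z w ∈ G)
    (hparC : ∀ j β' U a, C37 j β' U a → ∀ z w, parA j U z w ∈ G)
    (hunitG : ∀ j (α₀ : ℝ) (U : CfgY 𝔸 (f j).toKIdx), MInv ≤ (geo9Y (f j)).M → 0 < α₀ → (geo9Y (f j)).M * α₀ ≤ aInv →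
      (bg9YC 𝔸 G P (f j)).Reg335 c35 α₀ U → IsUnit (deltaPrimeAY (f j).toKIdx (parA j) U)) :
    StepH2Pos dB c35 (fun j => geo9Y (f j)) (fun j => (codingYx P G (f j) (C37 j) (C38 j)).bg)
      (fun j => KSCUPar P G (f j) (parA j) (parH j) (C37 j) (C38 j)) (fun j => KACU P G (f j) (OA j) (parB j) (C37 j) (C38 j))
      (fun j => pullS (codingYx P G (f j) (C37 j) (C38 j)) (Cinv j)) (fun j => KSCUPar P G (f j) (parA j) (parH j) (C37 j) (C38 j)) :=
  stepH2Pos_of_family_pos dB c35 (fun j => geo9Y (f j)) (fun j => (codingYx P G (f j) (C37 j) (C38 j)).bg)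
    (fun j => KSC₇Par P G (f j) (parA j) (parH j) (C37 j) (C38 j)) (fun j => KSCUPar P G (f j) (parA j) (parH j) (C37 j) (C38 j))
    (fun j => KACU P G (f j) (OA j) (parB j) (C37 j) (C38 j)) (fun j => KACU P G (f j) (OA j) (parB j) (C37 j) (C38 j))
    (fun j => pullS (codingYx P G (f j) (C37 j) (C38 j)) (Cinv j))
    (fun j => KSC₇Par P G (f j) (parA j) (parH j) (C37 j) (C38 j)) (fun j => KSCUPar P G (f j) (parA j) (parH j) (C37 j) (C38 j))
    (hin_KSCUPar_on_pos P f c35 G parA parH OA parB b ιB C37 C38 Cinv hι hG1 hM₂ hrepr dB)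
    (fun Bεβ δ a hδ ha => ⟨0, 1, a, Bεβ, δ, one_pos, ha, le_rfl, hδ,
      fun j _ _ _ _ _ _ _ _ _ _ _ h => (h2Block_KSC₇Par_iff P G (f j) (parA j) (parH j) (C37 j) (C38 j) _).1 h⟩)
    (stepH2Pos_KSC₇ParG_on P f c35 G parA parH b ιB C37 C38 hι hG1 dB M₂ hM₂ hrepr hcR Cq hCq hC37 MInv aInv aW hMInv haInv haW hparG hparC hunitG _ _)

end H2

end Literature.MathematicalPhysics.QuantumFieldTheory.Balaban1983to89.B9SectBStepsUParG

end
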